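import Mathlib.Probability.Distributions.Gaussian.Real
import Mathlib.Probability.Distributions.Gaussian.Multivariate
import Mathlib.Probability.ProbabilityMassFunction.Constructions
import Mathlib.MeasureTheory.Constructions.Pi
import Mathlib.MeasureTheory.Integral.Bochner.Basic
import Mathlib.Analysis.Complex.ExponentialBounds
import Literature.Computability.QuantumComplexity.QueryComplexity
import Literature.Computability.QuantumComplexity.Forrelation
import Literature.Probability.RandomGraphs.LowDegree
import HarnessLib

/-!
# The Raz–Tal distribution and the two halves of `BQP ⊄ PH` relative to an oracle

Topic `Literature/Computability/QuantumComplexity`; decomposition of the named fact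
`Literature.Computability.QuantumComplexity.raz_tal_forrelation` (**quantum-advantage.S15**, file `QueryComplexity`)
into the results of R. Raz, A. Tal, *Oracle separation of BQP and PH*, J. ACM 69 (2022),
Art. 30 (conference version STOC 2019; ECCC TR18-107, same numbering), as printed there:

* §3.1, §4: the Hadamard transform `H_N` (`N = 2ⁿ`), the Gaussian `𝒢' = √ε · (x, H_N x)`,
  `x ∼ 𝒩(0, I_N)`, `ε = 1/(24 ln N)`, the truncation `trnc`, and **the distribution `𝒟`** on
  `{±1}^{2N}` obtained from `z ∼ 𝒢'` by independent randomized rounding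
  (`zᵢ' = 1` with probability `(1 + trnc zᵢ)/2`). Here `𝒟` is a *real* definition
  `razTalDistribution n : PMF (Fin (2 * 2 ^ n) → Bool)` whose weights are the integrals
  `razTalDensity n w = ∫ ∏ᵢ (1 + χ(wᵢ) trnc zᵢ)/2 d𝒢'(z)`; that they sum to `1` is proved
  (`sum_razTalDensity`).
* §3.1: `H_N H_N = I_N` (`hadamardMatrix_mul_self`, proved); §4.1–4.2, Claim 4.1(1): the
  covariance of `𝒢'` is `ε · [[I, H], [H, I]]` (`integral_mul_razTalGaussian`,
  `integral_x_mul_y`, …, proved from Mathlib's `gaussianReal` moments); §5, Eq. (2) for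
  characters and for `φ` (`charMean_razTalDistribution`, `sum_razTalDistribution_forrelationPhi`,
  proved); §6: `φ(x,y) = (1/N) ∑ xᵢ H_{ij} yⱼ` (`forrelationPhi`), Claim 6.1 (`𝔼_U φ = 0`,
  `sum_forrelationPhi_sgn`) and Claim 6.2 (`𝔼_{𝒢'} φ = ε`, `integral_forrelationPhi`), proved.
* §7, Lemma 7.1 (= Tal, CCC 2017, Thm 37): the level-`k` Fourier `L₁`-mass of a size-`s`
  depth-`d` AC⁰ circuit is at most `(c log s)^{(d-1)k}` — named fact `Tal2017_fourierL1_ac0`.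
* §7, Theorem 7.4: `|𝔼_{𝒟} A − 𝔼_U A| ≤ 32 ε (c log s)^{2(d-1)} N^{-1/2}` for `{±1}`-valued
  circuits, i.e. `≤ 16 ε (c log s)^{2(d-1)}/√N` for acceptance probabilities — named fact
  `RazTal2022_thm74`.
* §6, Corollary 6.4: a one-query quantum algorithm has advantage `≥ ε/2` in `{±1}`-expectation,
  i.e. `≥ ε/4` in acceptance probability — named fact `RazTal2022_cor64`, PROVED here
  (`razTal2022_cor64_holds`): it is reduced (`razTal2022_cor64_of`, via Claims 6.1, 6.2 and
  Eq. (2)) to `RazTal2022_oneQueryAlg` (the Aaronson–Ambainis one-query algorithm accepts with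
  probability `(1 + φ)/2`, [AA15, Prop. 6] as quoted in §6, in H21's query model) and
  `RazTal2022_truncation_phi` (Claim 6.3's estimate `𝔼_{𝒢'}|φ(trnc z) − φ(z)| ≤ 8 N^{-2}`), and
  both are proved (`razTal2022_oneQueryAlg_holds`, `razTal2022_truncation_phi_holds`).
* §2.2/§6: the **one-query algorithm** `forrelationAlg n : QQueryAlg (2N)` (unitaries
  `H_{2N} ⊗ H₂ ⊗ 1` and `V ⊗ 1` via `Matrix.kronecker`, `V = 2^{-1/2}[[H_N, I], [H_N, -I]]`) with
  `acceptProb_forrelationAlg : acceptProb w = (1 + φ(χ(w)))/2` PROVED.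
* §4.1: **both halves of `z = (x, y) ∼ 𝒢'` are `𝒩(0, ε I_N)`** (`map_xBlock_razTalGaussian`,
  `map_yBlock_razTalGaussian`, proved; the `y`-half through the rotation invariance of
  `𝒩(0, I_N)`, `pi_gaussianReal_map_mulVec`), and the one-dimensional Gaussian tail estimate
  `∫ t² 𝟙_{|t|>1} d𝒩(0,v) ≤ 2e^{-1/(2v)}` (`integral_sqTail_gaussianReal_le`, from the moment
  generating function), `= 2N^{-12}` at `v = ε`.
* §5: **multilinear functions** `F(z) = ∑_S F̂(S) ∏_{i∈S} zᵢ` (`multilinearEval`), the cube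
  interpolation `F(z) = ∑_w F(w) ∏ᵢ (1 + wᵢzᵢ)/2` (`multilinearEval_eq_sum_cube`), **Claim 5.1**
  (`razTal_claim51`: `|F(z)| ≤ ∏ max(1,|zᵢ|)`), **Claim 5.2** (`razTal_claim52`:
  `𝔼_{𝒢'}[∏ max(1,|zᵢ|) 𝟙_{z ≠ trnc z}] ≤ 4N^{-2}`; our proof replaces the paper's counting of
  integer boxes by a union bound over coordinates and AM–GM, with the same Gaussian tail input)
  and **Claim 5.3** (`razTal_claim53`: `𝔼_{𝒢'}|F(trnc(z₀ + pz)) − F(z₀ + pz)| ≤ 8N^{-2}`), all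
  PROVED for every `n ≥ 1`; Claim 6.3's truncation estimate is Claim 5.3 for `φ`
  (`phiCoeff`, `abs_forrelationPhi_sgn_le`).
* §8.1 (proof of Thm 1.1) plus elementary constant bookkeeping: the **assembly**
  `raz_tal_forrelation_of_thm74_cor64 : RazTal2022_thm74 → RazTal2022_cor64 →
  raz_tal_forrelation`, proved here, whence `raz_tal_forrelation_of_thm74 : RazTal2022_thm74 →
  raz_tal_forrelation`: **S15 now rests on Theorem 7.4 alone** (the AC⁰ side, itself resting on
  Tal's Lemma 7.1). Small `n` (the paper assumes `n` sufficiently large, §4) are patched with the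
  Dirac distribution and the one-query algorithm reading one bit (`readBitAlg`), for which
  part (1) of S15 is trivially satisfied (LHS `≤ 1 ≤` RHS) once `C ≥ n₀` and part (2) holds
  with advantage `1/2`.

Conventions. Booleans are read in `{±1}` through `Literature.Probability.RandomGraphs.LowDegree.sgn` (`true ↦ -1`; the Walsh
characters `walsh` of file `Probability/RandomGraphs/LowDegree` are reused for Fourier
coefficients; `signOf` of file `Forrelation` is the same function);
the block structure `{±1}^{2N} = {±1}^N × {±1}^N` is `splitIndex : Fin (2N) ≃ Fin N ⊕ Fin N`
(first block `x`, second block `y`). H21's circuit model (`Circuit`, basis `acBasis`, `acDepth`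
with free negations, `size` = number of gates) allows negations anywhere; pushing them to the
inputs at most doubles the size and keeps the depth, which the existential constant `c` of the
facts absorbs (all facts carry `2 ≤ s`). H21's quantum query model (`QQueryAlg`, bit-flip oracle
with an index register) realises the phase oracle `|i⟩ ↦ zᵢ|i⟩` of Raz–Tal §3.2 by phase
kick-back, so "one query" means the same thing. Running-time clauses (`O(log N)`) are not part of
the query model and are dropped.

Library notes. Mathlib supplies `gaussianReal`, `Measure.pi`, `PMF.ofFintype`, and (file
`Probability/Distributions/Gaussian/Multivariate`) `ProbabilityTheory.stdGaussian E` and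
`multivariateGaussian μ S` on `EuclideanSpace ℝ ι` with a covariance API
(`covariance_eval_multivariateGaussian`). Raz–Tal define `𝒢'` by its covariance matrix
`ε · [[I, H], [H, I]]` (§4.2) *and* by the sampling procedure `z = √ε (x, H_N x)`, `x ∼ 𝒩(0, I_N)`
(§4.1, steps 1–2); we take the latter as the definition,
`razTalGaussian n = (Measure.pi gaussianReal 0 1).map (razTalSample n)` on `Fin (2N) → ℝ`, and
prove the covariance matrix as a theorem (`integral_mul_razTalGaussian`), because (i) all
expectations needed here (`𝒟`'s weights, Eq. (2), Claims 5.2 and 6.2) are integrals of explicit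
functions of the coordinates, computed by `integral_map` and `integral_fintype_prod_eq_prod` on
`Measure.pi`; (ii) the covariance is singular (rank `N`), so `multivariateGaussian 0 S` (defined
through `CFC.sqrt S`) offers no simpler description; (iii) the block laws needed for the tail
estimates (`map_xBlock_razTalGaussian`, `map_yBlock_razTalGaussian`: both halves of `z` are
`𝒩(0, ε I_N)`) follow from `Measure.pi_map_pi` and the orthogonal invariance of
`Measure.pi gaussianReal 0 1`, itself obtained from Mathlib's `stdGaussian_eq_map_pi_orthonormalBasis`
(`pi_gaussianReal_map_mulVec`). Mathlib's `stdGaussian (EuclideanSpace ℝ (Fin N))` is the image of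
our `stdGaussianPi N` under `toLp 2` (`map_pi_eq_stdGaussian`); a later discharge of
`RazTal2022_thm74` needing Isserlis/Wick moments (Claim 4.1(2–4)) can transport along these
identifications. Mathlib has no Hadamard transform or Boolean Fourier coefficients (searched
`hadamard`, `walsh`, `fourierCoeff` on the cube), so these are defined here in elementary form,
the Hadamard sign through the `twist` of file `Forrelation`.
-/

namespace Literature.Computability.QuantumComplexity

open MeasureTheory ProbabilityTheory Finset Matrix Complexity Cryptography Literature.Probability.RandomGraphs.LowDegree

/-! ### The Hadamard transform -/

/-- The sign `(-1)^{⟨i,j⟩}`, `⟨i,j⟩` the inner product of the binary representations of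
`i, j < 2ⁿ` (Raz–Tal, §3.1): the `twist` of file `Forrelation` (Aaronson–Ambainis' `(-1)^{x·y}`,
the product over bit positions `l < n` of `(-1)^{iₗ jₗ}`) applied to the bit vectors of `i` and
`j`. [cite: RazTalJACM2022, §3.1] -/
def hadamardSign (n : ℕ) (i j : Fin (2 ^ n)) : ℝ :=
  twist (fun l : Fin n => i.val.testBit l) (fun l : Fin n => j.val.testBit l)

/-- The Hadamard transform `H_N ∈ ℝ^{N×N}`, `N = 2ⁿ`: `(H_N)_{ij} = N^{-1/2} (-1)^{⟨i,j⟩}`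
(Raz–Tal, §3.1). [cite: RazTalJACM2022, §3.1] -/
noncomputable def hadamardMatrix (n : ℕ) : Matrix (Fin (2 ^ n)) (Fin (2 ^ n)) ℝ :=
  fun i j => hadamardSign n i j / Real.sqrt (2 ^ n)

/-- `H_N` is symmetric at the level of signs (Raz–Tal, §3.1; `twist_comm`). [cite: RazTalJACM2022, §3.1] -/
theorem hadamardSign_comm (n : ℕ) (i j : Fin (2 ^ n)) :
    hadamardSign n i j = hadamardSign n j i :=
  twist_comm _ _

/-- The signs are `±1` (Raz–Tal, §3.1; `abs_twist`). [cite: RazTalJACM2022, §3.1] -/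
theorem abs_hadamardSign (n : ℕ) (i j : Fin (2 ^ n)) : |hadamardSign n i j| = 1 :=
  abs_twist _ _

/-- The `{±1}`-reading `signOf` of file `Forrelation` (Aaronson–Ambainis) is the character `sgn`
of file `LowDegree` used throughout this file. [folklore] -/
@[simp] theorem signOf_eq_sgn : signOf = sgn := rfl

/-- Every entry of `H_N` has square `1/N` (Raz–Tal, §3.1 and Claim 4.1(1)). [cite: RazTalJACM2022, §3.1] -/
theorem hadamardMatrix_sq (n : ℕ) (i j : Fin (2 ^ n)) :
    hadamardMatrix n i j ^ 2 = 1 / 2 ^ n := by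
  unfold hadamardMatrix
  have h := abs_hadamardSign n i j
  rw [div_pow, ← sq_abs, h, one_pow, Real.sq_sqrt (by positivity)]

/-! ### Truncation and the parameter `ε` -/

/-- `trnc(a) = min(1, max(-1, a))`, truncation of a real to `[-1, 1]` (Raz–Tal, §4.2). [cite: RazTalJACM2022, §4.2] -/
noncomputable def trnc (a : ℝ) : ℝ := min 1 (max (-1) a)

/-- `trnc a ∈ [-1, 1]` (Raz–Tal, §4.2). [cite: RazTalJACM2022, §4.2] -/
theorem abs_trnc_le_one (a : ℝ) : |trnc a| ≤ 1 := by
  unfold trnc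
  rw [abs_le]
  constructor
  · exact le_min (by norm_num) (le_max_left _ _)
  · exact min_le_left _ _

/-- On `[-1, 1]` truncation is the identity (Raz–Tal, §4.2). [cite: RazTalJACM2022, §4.2] -/
theorem trnc_eq_self {a : ℝ} (h : |a| ≤ 1) : trnc a = a := by
  rw [abs_le] at h
  unfold trnc
  rw [max_eq_right h.1, min_eq_right h.2]

/-- Truncation is continuous (used for measurability of the rounding weights). [folklore] -/
theorem continuous_trnc : Continuous trnc :=
  continuous_const.min (continuous_const.max continuous_id)

/-- The variance parameter `ε = 1/(24 · ln N)` of Raz–Tal, §4.2. Junk value: for `N ≤ 1`,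
`ln N = 0` and Lean's `1/0 = 0` give `ε = 0` (then `𝒢'` is the point mass at `0` and `𝒟` is
uniform); all statements use `N = 2ⁿ` with `n` large or `n ≥ 1`. [cite: RazTalJACM2022, §4.2] -/
noncomputable def razTalEps (N : ℕ) : ℝ := 1 / (24 * Real.log N)

/-! ### The Gaussian `𝒢'` -/

/-- The standard Gaussian `𝒩(0, I_N)` on `ℝ^N` as the product of `N` standard real Gaussians
(Raz–Tal, §4.1, step 1). [cite: RazTalJACM2022, §4.1] -/
noncomputable def stdGaussianPi (N : ℕ) : Measure (Fin N → ℝ) :=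
  Measure.pi fun _ => gaussianReal 0 1

/-- `𝒩(0, I_N)` is a probability measure. [folklore] -/
instance (N : ℕ) : IsProbabilityMeasure (stdGaussianPi N) := by
  unfold stdGaussianPi; infer_instance

/-- The identification `[2N] = [N] ⊔ [N]` of the two blocks `z = (x, y)` (Raz–Tal, §4.1). [cite: RazTalJACM2022, §4.1] -/
def splitIndex (N : ℕ) : Fin (2 * N) ≃ Fin N ⊕ Fin N :=
  (finCongr (two_mul N)).trans finSumFinEquiv.symm

/-- The sample map of `𝒢'`: `x ↦ z = √ε · (x, H_N x) ∈ ℝ^{2N}` (Raz–Tal, §4.1–4.2). [cite: RazTalJACM2022, §4.2] -/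
noncomputable def razTalSample (n : ℕ) (x : Fin (2 ^ n) → ℝ) (k : Fin (2 * 2 ^ n)) : ℝ :=
  Real.sqrt (razTalEps (2 ^ n)) *
    Sum.elim x (fun j => (hadamardMatrix n).mulVec x j) (splitIndex (2 ^ n) k)

/-- The sample map is continuous (linear). [folklore] -/
theorem continuous_razTalSample (n : ℕ) : Continuous (razTalSample n) := by
  refine continuous_pi fun k => ?_
  unfold razTalSample
  refine continuous_const.mul ?_
  cases splitIndex (2 ^ n) k with
  | inl i => exact continuous_apply i
  | inr j =>
    simp only [Sum.elim_inr, Matrix.mulVec, dotProduct]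
    exact continuous_finsetSum _ fun i _ => continuous_const.mul (continuous_apply i)

/-- The multivariate Gaussian `𝒢'` on `ℝ^{2N}` with covariance `ε · [[I, H], [H, I]]`: the law
of `√ε (x, H_N x)`, `x ∼ 𝒩(0, I_N)` (Raz–Tal, §4.2). [cite: RazTalJACM2022, §4.2] -/
noncomputable def razTalGaussian (n : ℕ) : Measure (Fin (2 * 2 ^ n) → ℝ) :=
  (stdGaussianPi (2 ^ n)).map (razTalSample n)

/-- `𝒢'` is a probability measure. [folklore] -/
instance (n : ℕ) : IsProbabilityMeasure (razTalGaussian n) :=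
  Measure.isProbabilityMeasure_map (continuous_razTalSample n).measurable.aemeasurable

/-! ### Randomized rounding and the distribution `𝒟` -/

/-- The rounding kernel: given `z ∈ ℝ^m`, the probability of the sign pattern `w ∈ {±1}^m`
(Booleans read through `sgn`) when each coordinate is set independently to `σ ∈ {±1}` with
probability `(1 + σ · trnc zᵢ)/2` (Raz–Tal, §4.2, "The distribution 𝒟"). [cite: RazTalJACM2022, §4.2] -/
noncomputable def roundingWeight {m : ℕ} (z : Fin m → ℝ) (w : Fin m → Bool) : ℝ :=
  ∏ i, (1 + sgn (w i) * trnc (z i)) / 2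

/-- Each rounding factor lies in `[0, 1]`. [cite: RazTalJACM2022, §4.2] -/
theorem roundingFactor_mem {m : ℕ} (z : Fin m → ℝ) (w : Fin m → Bool) (i : Fin m) :
    0 ≤ (1 + sgn (w i) * trnc (z i)) / 2 ∧ (1 + sgn (w i) * trnc (z i)) / 2 ≤ 1 := by
  have habs : |sgn (w i)| = 1 := by cases w i <;> simp
  have h : |sgn (w i) * trnc (z i)| ≤ 1 := by
    rw [abs_mul, habs, one_mul]; exact abs_trnc_le_one _
  rw [abs_le] at h
  constructor <;> linarith [h.1, h.2]

/-- Rounding weights are nonnegative. [cite: RazTalJACM2022, §4.2] -/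
theorem roundingWeight_nonneg {m : ℕ} (z : Fin m → ℝ) (w : Fin m → Bool) :
    0 ≤ roundingWeight z w :=
  Finset.prod_nonneg fun i _ => (roundingFactor_mem z w i).1

/-- Rounding weights are at most `1`. [cite: RazTalJACM2022, §4.2] -/
theorem roundingWeight_le_one {m : ℕ} (z : Fin m → ℝ) (w : Fin m → Bool) :
    roundingWeight z w ≤ 1 :=
  Finset.prod_le_one (fun i _ => (roundingFactor_mem z w i).1) fun i _ => (roundingFactor_mem z w i).2

/-- The rounding kernel is a probability vector: `∑_w ∏ᵢ (1 + χ(wᵢ) trnc zᵢ)/2 = ∏ᵢ 1 = 1`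
(Raz–Tal, §4.2). [cite: RazTalJACM2022, §4.2] -/
theorem sum_roundingWeight {m : ℕ} (z : Fin m → ℝ) : ∑ w, roundingWeight z w = 1 := by
  unfold roundingWeight
  have h := Finset.prod_univ_sum (fun _ : Fin m => (Finset.univ : Finset Bool))
    (fun i b => (1 + sgn b * trnc (z i)) / 2)
  rw [Fintype.piFinset_univ] at h
  rw [← h]
  refine Finset.prod_eq_one fun i _ => ?_
  simp [sgn]
  ring

/-- The rounding kernel is continuous in `z`. [folklore] -/
theorem continuous_roundingWeight {m : ℕ} (w : Fin m → Bool) :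
    Continuous fun z : Fin m → ℝ => roundingWeight z w := by
  unfold roundingWeight
  refine continuous_finsetProd _ fun i _ => ?_
  exact (continuous_const.add
    (continuous_const.mul (continuous_trnc.comp (continuous_apply i)))).div_const _

/-- The weight of `w ∈ {±1}^{2N}` under `𝒟`: `𝒟(w) = 𝔼_{z ∼ 𝒢'} ∏ᵢ (1 + χ(wᵢ) trnc zᵢ)/2`
(Raz–Tal, §4.2). [cite: RazTalJACM2022, §4.2] -/
noncomputable def razTalDensity (n : ℕ) (w : Fin (2 * 2 ^ n) → Bool) : ℝ :=
  ∫ z, roundingWeight z w ∂(razTalGaussian n)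

/-- `𝒟(w) ≥ 0`. [cite: RazTalJACM2022, §4.2] -/
theorem razTalDensity_nonneg (n : ℕ) (w : Fin (2 * 2 ^ n) → Bool) : 0 ≤ razTalDensity n w :=
  integral_nonneg fun z => roundingWeight_nonneg z w

/-- The rounding weights are integrable against `𝒢'` (bounded and continuous). [folklore] -/
theorem integrable_roundingWeight (n : ℕ) (w : Fin (2 * 2 ^ n) → Bool) :
    Integrable (fun z => roundingWeight z w) (razTalGaussian n) :=
  Integrable.of_bound (continuous_roundingWeight w).aestronglyMeasurable 1
    (ae_of_all _ fun z => by
      rw [Real.norm_eq_abs, abs_of_nonneg (roundingWeight_nonneg z w)]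
      exact roundingWeight_le_one z w)

/-- `∑_w 𝒟(w) = 1` (Raz–Tal, §4.2: `𝒟` is a probability distribution). [cite: RazTalJACM2022, §4.2] -/
theorem sum_razTalDensity (n : ℕ) : ∑ w, razTalDensity n w = 1 := by
  unfold razTalDensity
  rw [← integral_finsetSum _ fun w _ => integrable_roundingWeight n w]
  simp [sum_roundingWeight]

/-- **The Raz–Tal distribution `𝒟`** on `{±1}^{2N}`, `N = 2ⁿ` (Booleans read through `sgn`):
draw `z ∼ 𝒢'`, and independently for each `i` output `+1` with probability `(1 + trnc zᵢ)/2`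
(Raz–Tal, §4.2, "The distribution 𝒟"; the distribution `D` of Thm 1.1). [cite: RazTalJACM2022, §4.2] -/
noncomputable def razTalDistribution (n : ℕ) : PMF (Fin (2 * 2 ^ n) → Bool) :=
  PMF.ofFintype (fun w => ENNReal.ofReal (razTalDensity n w)) (by
    rw [← ENNReal.ofReal_sum_of_nonneg fun w _ => razTalDensity_nonneg n w, sum_razTalDensity,
      ENNReal.ofReal_one])

/-- Unfolding `𝒟(w)`. [cite: RazTalJACM2022, §4.2] -/
theorem razTalDistribution_apply (n : ℕ) (w : Fin (2 * 2 ^ n) → Bool) :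
    razTalDistribution n w = ENNReal.ofReal (razTalDensity n w) := rfl

/-- `𝒟(w)` as a real number is the integral `razTalDensity n w`. [cite: RazTalJACM2022, §4.2] -/
theorem toReal_razTalDistribution_apply (n : ℕ) (w : Fin (2 * 2 ^ n) → Bool) :
    (razTalDistribution n w).toReal = razTalDensity n w := by
  rw [razTalDistribution_apply, ENNReal.toReal_ofReal (razTalDensity_nonneg n w)]

/-! ### Randomized rounding preserves multilinear expectations (Eq. (2)) -/

/-- One coordinate of the rounding kernel against a character factor:
`∑_b (1 + χ(b) t)/2 · (χ(b) if i ∈ S else 1) = (t if i ∈ S else 1)` (Raz–Tal, §4.2: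
"the expected value of `zᵢ'` equals `trnc(zᵢ)`"). [cite: RazTalJACM2022, §4.2] -/
theorem sum_bool_roundingFactor_mul (t : ℝ) (p : Prop) [Decidable p] :
    ∑ b : Bool, (1 + sgn b * t) / 2 * (if p then sgn b else 1) = if p then t else 1 := by
  by_cases hp : p <;> simp [hp, sgn] <;> ring

/-- **Eq. (2) of Raz–Tal for characters, pointwise in `z`**: under the rounding kernel of `z`,
`𝔼[χ_S(z')] = ∏_{i∈S} trnc zᵢ` (Raz–Tal, §5, proof of Eq. (2): conditioned on `z` the
coordinates are independent with means `trnc zᵢ`). [cite: RazTalJACM2022, §5 Eq. (2)] -/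
theorem sum_roundingWeight_mul_walsh {m : ℕ} (z : Fin m → ℝ) (S : Finset (Fin m)) :
    ∑ w, roundingWeight z w * walsh S w = ∏ i ∈ S, trnc (z i) := by
  classical
  have key : ∀ w : Fin m → Bool, roundingWeight z w * walsh S w =
      ∏ i, ((1 + sgn (w i) * trnc (z i)) / 2 * (if i ∈ S then sgn (w i) else 1)) := by
    intro w
    rw [roundingWeight, walsh, Finset.prod_mul_distrib, ← Finset.prod_filter]
    simp
  simp_rw [key]
  have h := Finset.prod_univ_sum (fun _ : Fin m => (Finset.univ : Finset Bool))
    (fun i b => (1 + sgn b * trnc (z i)) / 2 * (if i ∈ S then sgn b else 1))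
  rw [Fintype.piFinset_univ] at h
  rw [← h]
  simp_rw [sum_bool_roundingFactor_mul]
  rw [← Finset.prod_filter]
  simp

/-- Nonconstant characters have mean zero under the uniform distribution:
`∑_x χ_S(x) = 0` for `S ≠ ∅` (used in Claim 6.1). [folklore] -/
theorem sum_walsh_eq_zero {m : ℕ} {S : Finset (Fin m)} (hS : S.Nonempty) :
    ∑ x : Fin m → Bool, walsh S x = 0 := by
  classical
  have key : ∀ x : Fin m → Bool, walsh S x = ∏ i, (if i ∈ S then sgn (x i) else 1) := by
    intro x
    rw [walsh, ← Finset.prod_filter]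
    simp
  simp_rw [key]
  have h := Finset.prod_univ_sum (fun _ : Fin m => (Finset.univ : Finset Bool))
    (fun i b => (if i ∈ S then sgn b else (1 : ℝ)))
  rw [Fintype.piFinset_univ] at h
  rw [← h]
  obtain ⟨i, hi⟩ := hS
  exact Finset.prod_eq_zero (Finset.mem_univ i) (by simp [hi, sgn])

/-- **Eq. (2) of Raz–Tal for characters**: `𝔼_{z'∼𝒟}[χ_S(z')] = 𝔼_{z∼𝒢'}[∏_{i∈S} trnc zᵢ]`
(Raz–Tal, §5, Eq. (2), for `F = χ_S`; the general multilinear `F` follows by linearity). [cite: RazTalJACM2022, §5 Eq. (2)] -/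
theorem charMean_razTalDistribution (n : ℕ) (S : Finset (Fin (2 * 2 ^ n))) :
    charMean (razTalDistribution n) S = ∫ z, ∏ i ∈ S, trnc (z i) ∂(razTalGaussian n) := by
  unfold charMean
  simp_rw [toReal_razTalDistribution_apply, razTalDensity, ← integral_mul_const]
  rw [← integral_finsetSum _ (fun w _ => (integrable_roundingWeight n w).mul_const _)]
  simp_rw [sum_roundingWeight_mul_walsh]

/-! ### Orthogonality of the Hadamard transform -/

/-- Bit `l` of `j < 2ⁿ` is digit `l` of `j` in base `2` (`finFunctionFinEquiv`). [folklore] -/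
theorem testBit_fin {n : ℕ} (j : Fin (2 ^ n)) (l : Fin n) :
    j.val.testBit l = decide (finFunctionFinEquiv.symm j l = 1) := by
  simp [Nat.testBit_eq_decide_div_mod_eq, Fin.ext_iff]

/-- Orthogonality of the rows of signs: `∑_j (-1)^{⟨i,j⟩} (-1)^{⟨i',j⟩} = N [i = i']`
(Raz–Tal, §3.1: "`H_N` is orthonormal"). [cite: RazTalJACM2022, §3.1] -/
theorem sum_hadamardSign_mul (n : ℕ) (i i' : Fin (2 ^ n)) :
    ∑ j, hadamardSign n i j * hadamardSign n i' j = if i = i' then (2 : ℝ) ^ n else 0 := by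
  set g : Fin n → Bool → ℝ := fun l b =>
    (if (i.val.testBit l && b) then (-1 : ℝ) else 1) * (if (i'.val.testBit l && b) then (-1 : ℝ) else 1)
    with hg
  have key : ∀ j : Fin (2 ^ n), hadamardSign n i j * hadamardSign n i' j =
      ∏ l, g l (decide (finFunctionFinEquiv.symm j l = 1)) := by
    intro j
    rw [hadamardSign, hadamardSign, twist, twist, ← Finset.prod_mul_distrib]
    refine Finset.prod_congr rfl fun l _ => ?_
    simp [hg, testBit_fin]
  simp_rw [key]
  have hsum : ∑ j : Fin (2 ^ n), ∏ l, g l (decide (finFunctionFinEquiv.symm j l = 1)) =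
      ∑ f : Fin n → Fin 2, ∏ l, g l (decide (f l = 1)) :=
    finFunctionFinEquiv.symm.sum_comp (fun f : Fin n → Fin 2 => ∏ l, g l (decide (f l = 1)))
  rw [hsum]
  have h := Finset.prod_univ_sum (fun _ : Fin n => (Finset.univ : Finset (Fin 2)))
    (fun l a => g l (decide (a = 1)))
  rw [Fintype.piFinset_univ] at h
  rw [← h]
  have hl : ∀ l : Fin n, ∑ a : Fin 2, g l (decide (a = 1)) =
      if i.val.testBit l = i'.val.testBit l then 2 else 0 := by
    intro l
    rw [Fin.sum_univ_two]
    simp only [hg]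
    cases i.val.testBit l <;> cases i'.val.testBit l <;> norm_num
  simp_rw [hl]
  split_ifs with hii
  · subst hii
    simp
  · have : ∃ l : Fin n, i.val.testBit l ≠ i'.val.testBit l := by
      by_contra hcon
      push Not at hcon
      apply hii
      apply Fin.ext
      apply Nat.eq_of_testBit_eq
      intro k
      by_cases hk : k < n
      · exact hcon ⟨k, hk⟩
      · push Not at hk
        rw [Nat.testBit_lt_two_pow (i.isLt.trans_le (Nat.pow_le_pow_right (by norm_num) hk)),
          Nat.testBit_lt_two_pow (i'.isLt.trans_le (Nat.pow_le_pow_right (by norm_num) hk))]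
    obtain ⟨l, hl⟩ := this
    exact Finset.prod_eq_zero (Finset.mem_univ l) (by simp [hl])

/-- **`H_N · H_N = I_N`** (Raz–Tal, §3.1). [cite: RazTalJACM2022, §3.1] -/
theorem hadamardMatrix_mul_self (n : ℕ) : hadamardMatrix n * hadamardMatrix n = 1 := by
  ext i i'
  simp only [Matrix.mul_apply, hadamardMatrix]
  have hs : ∀ j, hadamardSign n i j / Real.sqrt (2 ^ n) * (hadamardSign n j i' / Real.sqrt (2 ^ n)) =
      hadamardSign n i j * hadamardSign n i' j / 2 ^ n := by
    intro j
    rw [hadamardSign_comm n j i', div_mul_div_comm, ← sq, Real.sq_sqrt (by positivity)]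
  simp_rw [hs]
  rw [← Finset.sum_div, sum_hadamardSign_mul, Matrix.one_apply]
  split_ifs <;> simp

/-- `H_N` is symmetric (Raz–Tal, §3.1). [cite: RazTalJACM2022, §3.1] -/
theorem hadamardMatrix_transpose (n : ℕ) : (hadamardMatrix n).transpose = hadamardMatrix n := by
  ext i j
  simp [hadamardMatrix, hadamardSign_comm n j i]

/-- `H_N` is an isometry: `‖H_N x‖² = ‖x‖²` (Raz–Tal, §3.1, orthonormality; used for the
acceptance probability `(1 + φ)/2` of the one-query algorithm, §6). [cite: RazTalJACM2022, §3.1] -/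
theorem dotProduct_hadamard_mulVec (n : ℕ) (x : Fin (2 ^ n) → ℝ) :
    dotProduct ((hadamardMatrix n).mulVec x) ((hadamardMatrix n).mulVec x) = dotProduct x x := by
  rw [Matrix.dotProduct_mulVec, Matrix.vecMul_mulVec, hadamardMatrix_transpose, hadamardMatrix_mul_self,
    Matrix.vecMul_one]

/-! ### Second moments of `𝒢'` (Claim 4.1(1) and the covariance matrix) -/

/-- Coordinates of `𝒩(0, I_N)` are square integrable. [folklore] -/
theorem memLp_eval_stdGaussianPi (N : ℕ) (i : Fin N) :
    MemLp (fun x : Fin N → ℝ => x i) 2 (stdGaussianPi N) :=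
  (memLp_id_gaussianReal (μ := 0) (v := 1) 2).comp_measurePreserving
    (MeasureTheory.measurePreserving_eval (μ := fun _ : Fin N => gaussianReal 0 1) i)

/-- Products of two coordinates of `𝒩(0, I_N)` are integrable. [folklore] -/
theorem integrable_eval_mul_eval (N : ℕ) (i j : Fin N) :
    Integrable (fun x : Fin N → ℝ => x i * x j) (stdGaussianPi N) :=
  (memLp_eval_stdGaussianPi N i).integrable_mul (memLp_eval_stdGaussianPi N j)

/-- `𝔼[t²] = 1` for `t ∼ 𝒩(0,1)`. [folklore] -/
theorem integral_sq_gaussianReal_zero_one : ∫ t, t ^ 2 ∂(gaussianReal 0 1) = 1 := by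
  have h := variance_of_integral_eq_zero (μ := gaussianReal 0 1) (X := id) aemeasurable_id
    (by simp [integral_id_gaussianReal])
  rw [variance_id_gaussianReal] at h
  simpa using h.symm

/-- `𝔼[xᵢ xⱼ] = [i = j]` for `x ∼ 𝒩(0, I_N)` (Raz–Tal, §4.1: covariance `I_N` of the `x`-block). [cite: RazTalJACM2022, §4.1] -/
theorem integral_eval_mul_eval (N : ℕ) (i j : Fin N) :
    ∫ x, x i * x j ∂(stdGaussianPi N) = if i = j then 1 else 0 := by
  classical
  set f : Fin N → ℝ → ℝ := fun k t => (if k = i then t else 1) * (if k = j then t else 1) with hfdef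
  have hf : ∀ x : Fin N → ℝ, x i * x j = ∏ k, f k (x k) := by
    intro x
    simp only [hfdef]
    rw [Finset.prod_mul_distrib]
    simp
  simp_rw [hf]
  rw [stdGaussianPi, integral_fintype_prod_eq_prod]
  by_cases hij : i = j
  · subst hij
    rw [if_pos rfl, Finset.prod_eq_single i]
    · simp only [hfdef, if_true]
      simpa [sq] using integral_sq_gaussianReal_zero_one
    · intro k _ hk
      simp [hfdef, hk]
    · simp
  · rw [if_neg hij]
    apply Finset.prod_eq_zero (Finset.mem_univ i)
    simp [hfdef, hij, integral_id_gaussianReal]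

/-- The coefficient of `xᵢ` in coordinate `k` of the sample map `x ↦ (x, H_N x)`: the rows of the
block matrix `[I_N; H_N]` (Raz–Tal, §4.1). [cite: RazTalJACM2022, §4.1] -/
noncomputable def sampleCoeff (n : ℕ) (k : Fin (2 * 2 ^ n)) (i : Fin (2 ^ n)) : ℝ :=
  Sum.elim (fun i' => if i' = i then 1 else 0) (fun j => hadamardMatrix n j i) (splitIndex (2 ^ n) k)

/-- The sample map is `√ε` times the linear map with matrix `[I_N; H_N]`. [cite: RazTalJACM2022, §4.2] -/
theorem razTalSample_eq (n : ℕ) (x : Fin (2 ^ n) → ℝ) (k : Fin (2 * 2 ^ n)) :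
    razTalSample n x k = Real.sqrt (razTalEps (2 ^ n)) * ∑ i, sampleCoeff n k i * x i := by
  unfold razTalSample sampleCoeff
  congr 1
  cases splitIndex (2 ^ n) k with
  | inl i => simp
  | inr j => simp [Matrix.mulVec, dotProduct]

/-- `ε ≥ 0`. [cite: RazTalJACM2022, §4.2] -/
theorem razTalEps_nonneg (N : ℕ) : 0 ≤ razTalEps N := by
  unfold razTalEps
  have := Real.log_natCast_nonneg N
  positivity

/-- Expansion of `z_k z_l` along the sample map as a quadratic form in `x`. [folklore] -/
theorem sample_mul_expand (n : ℕ) (k l : Fin (2 * 2 ^ n)) (x : Fin (2 ^ n) → ℝ) :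
    razTalSample n x k * razTalSample n x l =
      ∑ i, ∑ i', razTalEps (2 ^ n) * (sampleCoeff n k i * sampleCoeff n l i') * (x i * x i') := by
  rw [razTalSample_eq, razTalSample_eq, mul_mul_mul_comm, Real.mul_self_sqrt (razTalEps_nonneg _),
    Finset.sum_mul_sum, Finset.mul_sum]
  refine Finset.sum_congr rfl fun i _ => ?_
  rw [Finset.mul_sum]
  refine Finset.sum_congr rfl fun i' _ => ?_
  ring

/-- `z_k z_l` (pulled back along the sample map) is integrable against `𝒩(0, I_N)`. [folklore] -/
theorem integrable_sample_mul (n : ℕ) (k l : Fin (2 * 2 ^ n)) :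
    Integrable (fun x => razTalSample n x k * razTalSample n x l) (stdGaussianPi (2 ^ n)) := by
  simp_rw [sample_mul_expand]
  refine integrable_finsetSum _ fun i _ => integrable_finsetSum _ fun i' _ => ?_
  exact (integrable_eval_mul_eval _ i i').const_mul _

/-- **The covariance matrix of `𝒢'`**: `𝔼_{z∼𝒢'}[z_k z_l] = ε ⟨a_k, a_l⟩`, `a_k` the `k`-th row
of `[I_N; H_N]`, i.e. `ε · [[I, H], [H, I]]_{kl}` (Raz–Tal, §4.2; Claim 4.1(1)). See
`integral_x_mul_y`, `integral_x_mul_x`, `integral_y_mul_y` for the block entries. [cite: RazTalJACM2022, Claim 4.1] -/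
theorem integral_mul_razTalGaussian (n : ℕ) (k l : Fin (2 * 2 ^ n)) :
    ∫ z, z k * z l ∂(razTalGaussian n) =
      razTalEps (2 ^ n) * ∑ i, sampleCoeff n k i * sampleCoeff n l i := by
  rw [razTalGaussian, integral_map (continuous_razTalSample n).measurable.aemeasurable
    (by fun_prop)]
  simp_rw [sample_mul_expand]
  rw [integral_finsetSum _ fun i _ => integrable_finsetSum _ fun i' _ =>
    (integrable_eval_mul_eval _ i i').const_mul _]
  simp_rw [integral_finsetSum _ fun i' _ => (integrable_eval_mul_eval _ _ i').const_mul _,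
    integral_const_mul, integral_eval_mul_eval]
  rw [Finset.mul_sum]
  refine Finset.sum_congr rfl fun i _ => ?_
  simp [Finset.sum_ite_eq]

/-- `z_k z_l` is integrable against `𝒢'`. [folklore] -/
theorem integrable_mul_razTalGaussian (n : ℕ) (k l : Fin (2 * 2 ^ n)) :
    Integrable (fun z : Fin (2 * 2 ^ n) → ℝ => z k * z l) (razTalGaussian n) := by
  rw [razTalGaussian, integrable_map_measure (by fun_prop)
    (continuous_razTalSample n).measurable.aemeasurable]
  exact integrable_sample_mul n k l

/-- The index of `xᵢ` in `z = (x, y) ∈ ℝ^{2N}` (Raz–Tal, §4.1). [cite: RazTalJACM2022, §4.1] -/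
def xIdx (n : ℕ) (i : Fin (2 ^ n)) : Fin (2 * 2 ^ n) := (splitIndex (2 ^ n)).symm (Sum.inl i)

/-- The index of `yⱼ` in `z = (x, y) ∈ ℝ^{2N}` (Raz–Tal, §4.1). [cite: RazTalJACM2022, §4.1] -/
def yIdx (n : ℕ) (j : Fin (2 ^ n)) : Fin (2 * 2 ^ n) := (splitIndex (2 ^ n)).symm (Sum.inr j)

/-- `xIdx` lands in the first block. [folklore] -/
@[simp] theorem splitIndex_xIdx (n : ℕ) (i : Fin (2 ^ n)) :
    splitIndex (2 ^ n) (xIdx n i) = Sum.inl i := by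
  simp [xIdx]

/-- `yIdx` lands in the second block. [folklore] -/
@[simp] theorem splitIndex_yIdx (n : ℕ) (j : Fin (2 ^ n)) :
    splitIndex (2 ^ n) (yIdx n j) = Sum.inr j := by
  simp [yIdx]

/-- The `x`- and `y`-blocks are disjoint. [folklore] -/
theorem xIdx_ne_yIdx (n : ℕ) (i j : Fin (2 ^ n)) : xIdx n i ≠ yIdx n j := by
  intro h
  have := congrArg (splitIndex (2 ^ n)) h
  simp at this

/-- Row `xᵢ` of `[I_N; H_N]` is the unit vector `eᵢ`. [folklore] -/
theorem sampleCoeff_xIdx (n : ℕ) (i t : Fin (2 ^ n)) :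
    sampleCoeff n (xIdx n i) t = if i = t then 1 else 0 := by
  simp [sampleCoeff, eq_comm]

/-- Row `yⱼ` of `[I_N; H_N]` is row `j` of `H_N`. [folklore] -/
theorem sampleCoeff_yIdx (n : ℕ) (j t : Fin (2 ^ n)) :
    sampleCoeff n (yIdx n j) t = hadamardMatrix n j t := by
  simp [sampleCoeff]

/-- **Claim 4.1(1)**: `𝔼_{𝒢'}[xᵢ yⱼ] = ε (H_N)_{ij}` (Raz–Tal, Claim 4.1(1), scaled by `ε` as in
§4.2, proof of Claim 6.2). [cite: RazTalJACM2022, Claim 4.1] -/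
theorem integral_x_mul_y (n : ℕ) (i j : Fin (2 ^ n)) :
    ∫ z, z (xIdx n i) * z (yIdx n j) ∂(razTalGaussian n) = razTalEps (2 ^ n) * hadamardMatrix n i j := by
  rw [integral_mul_razTalGaussian]
  simp_rw [sampleCoeff_xIdx, sampleCoeff_yIdx]
  simp [Finset.sum_ite_eq, hadamardMatrix, hadamardSign_comm n j i]

/-- `𝔼_{𝒢'}[xᵢ xᵢ'] = ε [i = i']` (Raz–Tal, §4.2, covariance block `ε I_N`). [cite: RazTalJACM2022, §4.2] -/
theorem integral_x_mul_x (n : ℕ) (i i' : Fin (2 ^ n)) :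
    ∫ z, z (xIdx n i) * z (xIdx n i') ∂(razTalGaussian n) =
      razTalEps (2 ^ n) * if i = i' then 1 else 0 := by
  rw [integral_mul_razTalGaussian]
  simp_rw [sampleCoeff_xIdx]
  congr 1
  by_cases h : i = i' <;> simp [h, Finset.sum_ite_eq]

/-- `𝔼_{𝒢'}[yⱼ yⱼ'] = ε [j = j']` (Raz–Tal, §4.2, covariance block `ε I_N`; uses
`H_N H_N = I_N`). [cite: RazTalJACM2022, §4.2] -/
theorem integral_y_mul_y (n : ℕ) (j j' : Fin (2 ^ n)) :
    ∫ z, z (yIdx n j) * z (yIdx n j') ∂(razTalGaussian n) =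
      razTalEps (2 ^ n) * if j = j' then 1 else 0 := by
  rw [integral_mul_razTalGaussian]
  simp_rw [sampleCoeff_yIdx]
  congr 1
  have h := congrFun (congrFun (hadamardMatrix_mul_self n) j) j'
  rw [Matrix.mul_apply, Matrix.one_apply] at h
  rw [← h]
  refine Finset.sum_congr rfl fun t _ => ?_
  rw [show hadamardMatrix n t j' = hadamardMatrix n j' t from by
    simp [hadamardMatrix, hadamardSign_comm n t j']]

/-! ### The Forrelation polynomial `φ` and Claims 6.1, 6.2 -/

/-- Raz–Tal's `φ(x, y) = (1/N) ∑_{i,j} xᵢ (H_N)_{ij} yⱼ` on `z = (x, y) ∈ ℝ^{2N}` (§6; the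
acceptance probability of the Aaronson–Ambainis one-query algorithm is `(1 + φ)/2`,
[AA15, Prop. 6]). A homogeneous multilinear polynomial of degree `2`. [cite: RazTalJACM2022, §6] -/
noncomputable def forrelationPhi (n : ℕ) (z : Fin (2 * 2 ^ n) → ℝ) : ℝ :=
  (∑ i, ∑ j, z (xIdx n i) * hadamardMatrix n i j * z (yIdx n j)) / 2 ^ n

/-- **Claim 6.2**: `𝔼_{z∼𝒢'}[φ(z)] = ε` (Raz–Tal, Claim 6.2). [cite: RazTalJACM2022, Claim 6.2] -/
theorem integral_forrelationPhi (n : ℕ) :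
    ∫ z, forrelationPhi n z ∂(razTalGaussian n) = razTalEps (2 ^ n) := by
  unfold forrelationPhi
  have hterm : ∀ (i j : Fin (2 ^ n)) (z : Fin (2 * 2 ^ n) → ℝ),
      z (xIdx n i) * hadamardMatrix n i j * z (yIdx n j) =
        hadamardMatrix n i j * (z (xIdx n i) * z (yIdx n j)) := by
    intros; ring
  simp_rw [hterm]
  have hint : ∀ i j : Fin (2 ^ n), Integrable
      (fun z : Fin (2 * 2 ^ n) → ℝ => hadamardMatrix n i j * (z (xIdx n i) * z (yIdx n j)))
      (razTalGaussian n) := fun i j => (integrable_mul_razTalGaussian n _ _).const_mul _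
  rw [integral_div, integral_finsetSum _ fun i _ => integrable_finsetSum _ fun j _ => hint i j]
  simp_rw [integral_finsetSum _ fun j _ => hint _ j, integral_const_mul, integral_x_mul_y]
  have hsq : ∀ i j : Fin (2 ^ n), hadamardMatrix n i j * (razTalEps (2 ^ n) * hadamardMatrix n i j) =
      razTalEps (2 ^ n) / 2 ^ n := by
    intro i j
    rw [mul_left_comm, ← sq, hadamardMatrix_sq]
    ring
  simp_rw [hsq]
  simp only [Finset.sum_const, Finset.card_univ, Fintype.card_fin, nsmul_eq_mul]
  push_cast
  field_simp

/-- **Claim 6.1**: `𝔼_{u∼U_{2N}}[φ(u)] = 0`, here as `∑_w φ(χ(w)) = 0` (Raz–Tal, Claim 6.1). [cite: RazTalJACM2022, Claim 6.1] -/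
theorem sum_forrelationPhi_sgn (n : ℕ) :
    ∑ w : Fin (2 * 2 ^ n) → Bool, forrelationPhi n (fun k => sgn (w k)) = 0 := by
  have hpair : ∀ i j : Fin (2 ^ n), ∑ w : Fin (2 * 2 ^ n) → Bool,
      sgn (w (xIdx n i)) * hadamardMatrix n i j * sgn (w (yIdx n j)) = 0 := by
    intro i j
    have h0 := sum_walsh_eq_zero (S := ({xIdx n i, yIdx n j} : Finset (Fin (2 * 2 ^ n))))
      ⟨xIdx n i, by simp⟩
    rw [← mul_zero (hadamardMatrix n i j), ← h0, Finset.mul_sum]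
    refine Finset.sum_congr rfl fun w _ => ?_
    rw [walsh, Finset.prod_pair (xIdx_ne_yIdx n i j)]
    ring
  unfold forrelationPhi
  rw [← Finset.sum_div, Finset.sum_comm]
  have hin : ∀ i : Fin (2 ^ n), ∑ w : Fin (2 * 2 ^ n) → Bool, ∑ j,
      sgn (w (xIdx n i)) * hadamardMatrix n i j * sgn (w (yIdx n j)) = 0 := by
    intro i
    rw [Finset.sum_comm]
    exact Finset.sum_eq_zero fun j _ => hpair i j
  simp [hin]

/-- `trnc(z_a) trnc(z_b)` is integrable against `𝒢'` (bounded, continuous). [folklore] -/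
theorem integrable_trnc_mul_trnc (n : ℕ) (a b : Fin (2 * 2 ^ n)) :
    Integrable (fun z : Fin (2 * 2 ^ n) → ℝ => trnc (z a) * trnc (z b)) (razTalGaussian n) := by
  refine Integrable.of_bound (Continuous.aestronglyMeasurable ?_) 1 (ae_of_all _ fun z => ?_)
  · exact ((continuous_trnc.comp (continuous_apply a)).mul (continuous_trnc.comp (continuous_apply b)))
  · rw [norm_mul, Real.norm_eq_abs, Real.norm_eq_abs]
    exact mul_le_one₀ (abs_trnc_le_one _) (abs_nonneg _) (abs_trnc_le_one _)

/-- **Eq. (2) for `φ`**: `𝔼_{z'∼𝒟}[φ(z')] = 𝔼_{z∼𝒢'}[φ(trnc z)]` (Raz–Tal, §5 Eq. (2) applied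
to the multilinear `φ`, first step of the proof of Claim 6.3). [cite: RazTalJACM2022, §5 Eq. (2)] -/
theorem sum_razTalDistribution_forrelationPhi (n : ℕ) :
    ∑ w, (razTalDistribution n w).toReal * forrelationPhi n (fun k => sgn (w k)) =
      ∫ z, forrelationPhi n (fun k => trnc (z k)) ∂(razTalGaussian n) := by
  have hpair : ∀ i j : Fin (2 ^ n),
      ∑ w, (razTalDistribution n w).toReal * (sgn (w (xIdx n i)) * sgn (w (yIdx n j))) =
        ∫ z, trnc (z (xIdx n i)) * trnc (z (yIdx n j)) ∂(razTalGaussian n) := by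
    intro i j
    have h := charMean_razTalDistribution n {xIdx n i, yIdx n j}
    unfold charMean at h
    simp_rw [walsh, Finset.prod_pair (xIdx_ne_yIdx n i j)] at h
    exact h
  have hint : ∀ i j : Fin (2 ^ n), Integrable (fun z : Fin (2 * 2 ^ n) → ℝ =>
      hadamardMatrix n i j * (trnc (z (xIdx n i)) * trnc (z (yIdx n j)))) (razTalGaussian n) :=
    fun i j => (integrable_trnc_mul_trnc n _ _).const_mul _
  unfold forrelationPhi
  have hterm1 : ∀ (i j : Fin (2 ^ n)) (w : Fin (2 * 2 ^ n) → Bool),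
      sgn (w (xIdx n i)) * hadamardMatrix n i j * sgn (w (yIdx n j)) =
        hadamardMatrix n i j * (sgn (w (xIdx n i)) * sgn (w (yIdx n j))) := by
    intros; ring
  have hterm2 : ∀ (i j : Fin (2 ^ n)) (z : Fin (2 * 2 ^ n) → ℝ),
      trnc (z (xIdx n i)) * hadamardMatrix n i j * trnc (z (yIdx n j)) =
        hadamardMatrix n i j * (trnc (z (xIdx n i)) * trnc (z (yIdx n j))) := by
    intros; ring
  simp_rw [hterm1, hterm2]
  rw [integral_div, integral_finsetSum _ fun i _ => integrable_finsetSum _ fun j _ => hint i j]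
  simp_rw [integral_finsetSum _ fun j _ => hint _ j, integral_const_mul, ← hpair]
  simp_rw [mul_div_assoc', ← Finset.sum_div]
  congr 1
  simp_rw [Finset.mul_sum]
  rw [Finset.sum_comm]
  refine Finset.sum_congr rfl fun i _ => ?_
  rw [Finset.sum_comm]
  refine Finset.sum_congr rfl fun j _ => ?_
  refine Finset.sum_congr rfl fun w _ => ?_
  ring

/-! ### Boolean Fourier coefficients and Tal's tail bound (Lemma 7.1) -/

/-- The Fourier–Walsh coefficient `f̂(S) = 𝔼_x [χ(f x) χ_S(x)]`, `χ_S(x) = ∏_{i∈S} (-1)^{xᵢ}`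
(`walsh S x`), of a Boolean function on `{0,1}^m` with values read in `{±1}` via `sgn`
(Raz–Tal, §7, Eq. (4); O'Donnell, *Analysis of Boolean functions*, 2014, §1.2).
[cite: RazTalJACM2022, §7 Eq. (4)] [cite: ODonnell2014, §1.2] -/
noncomputable def boolFourierCoeff {m : ℕ} (f : (Fin m → Bool) → Bool) (S : Finset (Fin m)) : ℝ :=
  (∑ x : Fin m → Bool, sgn (f x) * walsh S x) / 2 ^ m

/-- The level-`k` Fourier `L₁`-mass `∑_{|S| = k} |f̂(S)|` (Raz–Tal, §7, Lemma 7.1). [cite: RazTalJACM2022, Lemma 7.1] -/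
noncomputable def fourierL1Level {m : ℕ} (f : (Fin m → Bool) → Bool) (k : ℕ) : ℝ :=
  ∑ S ∈ (Finset.univ : Finset (Fin m)).powersetCard k, |boolFourierCoeff f S|

/-- **Tal's Fourier tail bound for AC⁰** (Raz–Tal, Lemma 7.1, quoting Tal, *Tight bounds on
the Fourier spectrum of AC⁰*, CCC 2017, Thm 37). There is a universal constant `c > 0` such
that for every Boolean circuit with at most `s` gates and depth at most `d` computing
`f : {±1}^m → {±1}`, and every `k`, `∑_{|S|=k} |f̂(S)| ≤ (c · log s)^{(d-1)k}`. H21 model: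
circuits over `acBasis` (unbounded fan-in `∧, ∨`, and `¬` anywhere), `acDepth` (negations
free), `size` (all gates); `2 ≤ s` is assumed (the bound is used with `log s ≥ log 2 > 0`; the
normal-form conversion to negations-at-inputs at most doubles `s`, absorbed in `c`). For
`d = 0` (`d - 1 = 0` in `ℕ`) the circuit is a literal and the bound `1` is correct. [cite: RazTalJACM2022, Lemma 7.1] -/
def Tal2017_fourierL1_ac0 : Prop :=
  ∃ c : ℝ, 0 < c ∧ ∀ (m : ℕ) (F : Circuit (Fin m)) (d s : ℕ), F.IsOver acBasis → F.acDepth ≤ d →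
    F.size ≤ s → 2 ≤ s → ∀ k : ℕ,
      fourierL1Level F.eval k ≤ (c * Real.log s) ^ ((d - 1) * k)

/-! ### Theorem 7.4 and Corollary 6.4 as named facts -/

/-- **Raz–Tal, Theorem 7.4** (`𝒟` fools bounded-depth circuits). There are a universal constant
`c > 0` (Tal's constant of Lemma 7.1, up to the factor absorbing H21's circuit normal form) and
`n₀` (the standing assumption "`n` sufficiently large" of §4) such that for `n ≥ n₀`, `N = 2ⁿ`,
`ε = 1/(24 ln N)`, every Boolean circuit `A` on `2N` inputs of size at most `s ≥ 2` and depth at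
most `d` satisfies `|𝔼_{z∼𝒟}[A(z)] − 𝔼_{u∼U}[A(u)]| ≤ 32 ε (c log s)^{2(d-1)} N^{-1/2}` for the
`{±1}`-valued reading of `A`, i.e. `≤ 16 ε (c log s)^{2(d-1)}/√N` for the acceptance indicator
used here. Expectations are finite sums, `𝔼_U g = (∑ g)/2^{2N}`. [cite: RazTalJACM2022, Thm. 7.4] -/
def RazTal2022_thm74 : Prop :=
  ∃ c : ℝ, 0 < c ∧ ∃ n₀ : ℕ, ∀ n : ℕ, n₀ ≤ n →
    ∀ (F : Circuit (Fin (2 * 2 ^ n))) (d s : ℕ), F.IsOver acBasis → F.acDepth ≤ d →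
      F.size ≤ s → 2 ≤ s →
      |∑ w, (razTalDistribution n w).toReal * (if F.eval w then (1 : ℝ) else 0) -
          (∑ w : Fin (2 * 2 ^ n) → Bool, if F.eval w then (1 : ℝ) else 0) / 2 ^ (2 * 2 ^ n)| ≤
        16 * razTalEps (2 ^ n) * (c * Real.log s) ^ (2 * (d - 1)) / Real.sqrt (2 ^ n : ℕ)

/-- **Raz–Tal, Corollary 6.4** (the quantum side). For `n` sufficiently large there is a quantum
algorithm making one query whose acceptance probabilities separate `𝒟` from uniform:
`|𝔼_{z∼𝒟} Q(z) − 𝔼_{u∼U} Q(u)| ≥ ε/2` for the `{±1}`-valued output, i.e. advantage `≥ ε/4`,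
`ε = 1/(24 ln N)`, in acceptance probability (the Aaronson–Ambainis Forrelation query
algorithm, accepting with probability `(1 + φ(x,y))/2`, Claims 6.1–6.3). Stated in H21's query
model `QQueryAlg` (the phase oracle of Raz–Tal §3.2 is one bit-flip query by phase kick-back);
the running-time clause `O(log N)` is not part of the query model. [cite: RazTalJACM2022, Cor. 6.4] -/
def RazTal2022_cor64 : Prop :=
  ∃ n₀ : ℕ, ∀ n : ℕ, n₀ ≤ n → ∃ A : QQueryAlg (2 * 2 ^ n), A.queries = 1 ∧
    razTalEps (2 ^ n) / 4 ≤
      |∑ w, (razTalDistribution n w).toReal * A.acceptProb w -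
          (∑ w : Fin (2 * 2 ^ n) → Bool, A.acceptProb w) / 2 ^ (2 * 2 ^ n)|

/-! ### The one-query Forrelation algorithm in H21's query model (§2.2, §6) -/

section OneQuery

open scoped Kronecker

/-- A real orthogonal matrix, complexified, is unitary. [folklore] -/
theorem map_ofRealHom_mem_unitaryGroup {m : Type*} [Fintype m] [DecidableEq m] {M : Matrix m m ℝ}
    (hM : M.transpose * M = 1) : M.map Complex.ofRealHom ∈ Matrix.unitaryGroup m ℂ := by
  rw [Matrix.mem_unitaryGroup_iff', star_eq_conjTranspose,
    ← Matrix.conjTranspose_map Complex.ofRealHom (fun x => by simp),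
    Matrix.conjTranspose_eq_transpose_of_trivial, ← Matrix.map_mul, hM,
    Matrix.map_one _ (by simp) (by simp)]

/-- The `2 × 2` Hadamard gate `H₂ = 2^{-1/2} [[1, 1], [1, -1]]` on the target qubit
(`false ↦ |0⟩`, `true ↦ |1⟩`). [folklore] -/
noncomputable def hadamard2 : Matrix Bool Bool ℝ :=
  fun b b' => (if b && b' then (-1 : ℝ) else 1) / Real.sqrt 2

/-- `H₂ᵀ H₂ = I`. [folklore] -/
theorem hadamard2_transpose_mul_self : hadamard2.transpose * hadamard2 = 1 := by
  ext b b'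
  rw [Matrix.mul_apply, Fintype.sum_bool, Matrix.one_apply]
  have h2 : Real.sqrt 2 * Real.sqrt 2 = 2 := Real.mul_self_sqrt (by norm_num)
  cases b <;> cases b' <;> simp [hadamard2, Matrix.transpose_apply] <;> field_simp <;>
    nlinarith [h2, Real.sqrt_nonneg 2]

/-- The Hadamard transform `H_{2N}` on the whole index register `[2N] ≃ [2^{n+1}]`. [folklore] -/
noncomputable def hadamardBig (n : ℕ) : Matrix (Fin (2 * 2 ^ n)) (Fin (2 * 2 ^ n)) ℝ :=
  Matrix.reindex (finCongr (pow_succ' 2 n)) (finCongr (pow_succ' 2 n)) (hadamardMatrix (n + 1))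

/-- `H_{2N}ᵀ H_{2N} = I`. [folklore] -/
theorem hadamardBig_transpose_mul_self (n : ℕ) : (hadamardBig n).transpose * hadamardBig n = 1 := by
  unfold hadamardBig
  rw [Matrix.transpose_reindex, Matrix.reindex_apply, Matrix.reindex_apply, hadamardMatrix_transpose,
    Matrix.submatrix_mul_equiv, hadamardMatrix_mul_self, Matrix.submatrix_one_equiv]

/-- The column of `H_{2N}` at index `0` is the uniform vector `(2N)^{-1/2}`. [folklore] -/
theorem hadamardBig_apply_zero (n : ℕ) (k : Fin (2 * 2 ^ n)) :
    hadamardBig n k (finCongr (pow_succ' 2 n) 0) = 1 / Real.sqrt (2 ^ (n + 1)) := by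
  unfold hadamardBig
  simp only [Matrix.reindex_apply, Matrix.submatrix_apply, hadamardMatrix]
  congr 1
  · unfold hadamardSign twist
    refine Finset.prod_eq_one fun l _ => ?_
    simp

/-- The final unitary on the index register: `(a, b) ↦ ((H_N a + b)/√2, (H_N a − b)/√2)` in the
block decomposition `[2N] = [N] ⊔ [N]` (Raz–Tal, §2.2/§6: "applying an appropriate unitary
transformation", after Aaronson–Ambainis). [cite: RazTalJACM2022, §6] -/
noncomputable def mixMatrix (n : ℕ) : Matrix (Fin (2 * 2 ^ n)) (Fin (2 * 2 ^ n)) ℝ :=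
  fun k k' =>
    (match splitIndex (2 ^ n) k, splitIndex (2 ^ n) k' with
      | Sum.inl i, Sum.inl i' => hadamardMatrix n i i'
      | Sum.inl i, Sum.inr j' => if i = j' then 1 else 0
      | Sum.inr j, Sum.inl i' => hadamardMatrix n j i'
      | Sum.inr j, Sum.inr j' => if j = j' then -1 else 0) / Real.sqrt 2

/-- Sums over `[2N]` split into the two blocks. [folklore] -/
theorem sum_splitIndex {β : Type*} [AddCommMonoid β] (n : ℕ) (f : Fin (2 * 2 ^ n) → β) :
    ∑ k, f k = ∑ i, f (xIdx n i) + ∑ j, f (yIdx n j) := by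
  rw [← (splitIndex (2 ^ n)).symm.sum_comp, Fintype.sum_sum_type]
  rfl

/-- Block `(x, x)` of `V` is `H_N/√2` (Raz–Tal, §2.2). [cite: RazTalJACM2022, §2.2] -/
theorem mixMatrix_xIdx_xIdx (n : ℕ) (i i' : Fin (2 ^ n)) :
    mixMatrix n (xIdx n i) (xIdx n i') = hadamardMatrix n i i' / Real.sqrt 2 := by
  simp [mixMatrix]
/-- Block `(x, y)` of `V` is `I_N/√2` (Raz–Tal, §2.2). [cite: RazTalJACM2022, §2.2] -/
theorem mixMatrix_xIdx_yIdx (n : ℕ) (i j' : Fin (2 ^ n)) :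
    mixMatrix n (xIdx n i) (yIdx n j') = (if i = j' then 1 else 0) / Real.sqrt 2 := by
  simp [mixMatrix]
/-- Block `(y, x)` of `V` is `H_N/√2` (Raz–Tal, §2.2). [cite: RazTalJACM2022, §2.2] -/
theorem mixMatrix_yIdx_xIdx (n : ℕ) (j i' : Fin (2 ^ n)) :
    mixMatrix n (yIdx n j) (xIdx n i') = hadamardMatrix n j i' / Real.sqrt 2 := by
  simp [mixMatrix]
/-- Block `(y, y)` of `V` is `-I_N/√2` (Raz–Tal, §2.2). [cite: RazTalJACM2022, §2.2] -/
theorem mixMatrix_yIdx_yIdx (n : ℕ) (j j' : Fin (2 ^ n)) :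
    mixMatrix n (yIdx n j) (yIdx n j') = (if j = j' then -1 else 0) / Real.sqrt 2 := by
  simp [mixMatrix]

/-- `xIdx` is injective. [folklore] -/
theorem xIdx_injective (n : ℕ) : Function.Injective (xIdx n) := fun i i' h => by
  simpa using congrArg (splitIndex (2 ^ n)) h
/-- `yIdx` is injective. [folklore] -/
theorem yIdx_injective (n : ℕ) : Function.Injective (yIdx n) := fun j j' h => by
  simpa using congrArg (splitIndex (2 ^ n)) h

/-- `Vᵀ V = I` for the mixing matrix (from `H_N H_N = I`). [folklore] -/
theorem mixMatrix_transpose_mul_self (n : ℕ) : (mixMatrix n).transpose * mixMatrix n = 1 := by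
  -- it suffices to check on block indices
  have hH := fun a b => congrFun (congrFun (hadamardMatrix_mul_self n) a) b
  simp only [Matrix.mul_apply, Matrix.one_apply] at hH
  have hsym : ∀ a b, hadamardMatrix n a b = hadamardMatrix n b a := fun a b => by
    simp [hadamardMatrix, hadamardSign_comm n a b]
  have h2 : Real.sqrt 2 * Real.sqrt 2 = 2 := Real.mul_self_sqrt (by norm_num)
  ext k k'
  rw [Matrix.mul_apply, sum_splitIndex, Matrix.one_apply]
  simp only [Matrix.transpose_apply]
  obtain ⟨a, ha⟩ : ∃ a, (splitIndex (2 ^ n)).symm a = k := ⟨_, Equiv.symm_apply_apply _ k⟩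
  obtain ⟨b, hb⟩ : ∃ b, (splitIndex (2 ^ n)).symm b = k' := ⟨_, Equiv.symm_apply_apply _ k'⟩
  subst ha hb
  rcases a with i | j <;> rcases b with i' | j'
  · change ∑ x, mixMatrix n (xIdx n x) (xIdx n i) * mixMatrix n (xIdx n x) (xIdx n i') +
        ∑ x, mixMatrix n (yIdx n x) (xIdx n i) * mixMatrix n (yIdx n x) (xIdx n i') =
      if xIdx n i = xIdx n i' then 1 else 0
    simp_rw [mixMatrix_xIdx_xIdx, mixMatrix_yIdx_xIdx, (xIdx_injective n).eq_iff]
    have hterm : ∀ x, hadamardMatrix n x i / Real.sqrt 2 * (hadamardMatrix n x i' / Real.sqrt 2) =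
        hadamardMatrix n i x * hadamardMatrix n x i' / 2 := by
      intro x; rw [hsym x i, div_mul_div_comm, h2]
    simp_rw [hterm, ← Finset.sum_div, hH]
    split_ifs <;> ring
  · change ∑ x, mixMatrix n (xIdx n x) (xIdx n i) * mixMatrix n (xIdx n x) (yIdx n j') +
        ∑ x, mixMatrix n (yIdx n x) (xIdx n i) * mixMatrix n (yIdx n x) (yIdx n j') =
      if xIdx n i = yIdx n j' then 1 else 0
    simp_rw [mixMatrix_xIdx_xIdx, mixMatrix_yIdx_xIdx, mixMatrix_xIdx_yIdx, mixMatrix_yIdx_yIdx,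
      if_neg (xIdx_ne_yIdx n i j')]
    simp_rw [div_mul_div_comm, ← Finset.sum_div]
    simp [Finset.sum_ite_eq', h2]
    ring
  · change ∑ x, mixMatrix n (xIdx n x) (yIdx n j) * mixMatrix n (xIdx n x) (xIdx n i') +
        ∑ x, mixMatrix n (yIdx n x) (yIdx n j) * mixMatrix n (yIdx n x) (xIdx n i') =
      if yIdx n j = xIdx n i' then 1 else 0
    simp_rw [mixMatrix_xIdx_xIdx, mixMatrix_yIdx_xIdx, mixMatrix_xIdx_yIdx, mixMatrix_yIdx_yIdx,
      if_neg (xIdx_ne_yIdx n i' j).symm]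
    simp_rw [div_mul_div_comm, ← Finset.sum_div]
    simp [Finset.sum_ite_eq', h2]
    ring
  · change ∑ x, mixMatrix n (xIdx n x) (yIdx n j) * mixMatrix n (xIdx n x) (yIdx n j') +
        ∑ x, mixMatrix n (yIdx n x) (yIdx n j) * mixMatrix n (yIdx n x) (yIdx n j') =
      if yIdx n j = yIdx n j' then 1 else 0
    simp_rw [mixMatrix_xIdx_yIdx, mixMatrix_yIdx_yIdx, (yIdx_injective n).eq_iff]
    simp_rw [div_mul_div_comm, ← Finset.sum_div, h2]
    by_cases hjj : j = j'
    · subst hjj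
      norm_num
    · simp [hjj, Ne.symm hjj]

/-- `U₀ = H_{2N} ⊗ H₂ ⊗ 1`: prepares the uniform superposition over the index register with the
target qubit in `|−⟩` from the basis state `|0⟩|1⟩|·⟩`. [cite: RazTalJACM2022, §2.2] -/
noncomputable def prepMatrix (n : ℕ) :
    Matrix (Fin (2 * 2 ^ n) × Bool × Unit) (Fin (2 * 2 ^ n) × Bool × Unit) ℂ :=
  (hadamardBig n).map Complex.ofRealHom ⊗ₖ
    ((hadamard2.map Complex.ofRealHom) ⊗ₖ (1 : Matrix Unit Unit ℂ))

/-- `U₁ = V ⊗ 1`, `V` the mixing matrix. [cite: RazTalJACM2022, §2.2] -/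
noncomputable def mixMatrixC (n : ℕ) :
    Matrix (Fin (2 * 2 ^ n) × Bool × Unit) (Fin (2 * 2 ^ n) × Bool × Unit) ℂ :=
  (mixMatrix n).map Complex.ofRealHom ⊗ₖ (1 : Matrix (Bool × Unit) (Bool × Unit) ℂ)

/-- `U₀` is unitary. [folklore] -/
theorem prepMatrix_mem (n : ℕ) :
    prepMatrix n ∈ Matrix.unitaryGroup (Fin (2 * 2 ^ n) × Bool × Unit) ℂ :=
  Matrix.kronecker_mem_unitary (map_ofRealHom_mem_unitaryGroup (hadamardBig_transpose_mul_self n))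
    (Matrix.kronecker_mem_unitary (map_ofRealHom_mem_unitaryGroup hadamard2_transpose_mul_self)
      (Submonoid.one_mem _))

/-- `U₁` is unitary. [folklore] -/
theorem mixMatrixC_mem (n : ℕ) :
    mixMatrixC n ∈ Matrix.unitaryGroup (Fin (2 * 2 ^ n) × Bool × Unit) ℂ :=
  Matrix.kronecker_mem_unitary (map_ofRealHom_mem_unitaryGroup (mixMatrix_transpose_mul_self n))
    (Submonoid.one_mem _)

/-- **The one-query Forrelation algorithm** of Aaronson–Ambainis as used by Raz–Tal (§2.2, §6),
in H21's query model: start in `|0⟩|1⟩`, apply `H_{2N} ⊗ H₂` (uniform superposition, target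
`|−⟩`), one query (phase kick-back `|k⟩ ↦ χ(w_k)|k⟩`), the mixing unitary `V ⊗ 1`, and accept
iff the index register lies in the first block. [cite: RazTalJACM2022, §6] -/
noncomputable def forrelationAlg (n : ℕ) : QQueryAlg (2 * 2 ^ n) where
  W := Unit
  queries := 1
  unitaries := fun j => if (j : ℕ) = 0 then ⟨prepMatrix n, prepMatrix_mem n⟩
    else ⟨mixMatrixC n, mixMatrixC_mem n⟩
  start := (finCongr (pow_succ' 2 n) 0, true, ())
  accept := {s | (splitIndex (2 ^ n) s.1).isLeft = true}

/-- `χ(b ⊕ c) = χ(b) χ(c)`. [folklore] -/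
theorem sgn_xor (b c : Bool) : sgn (b ^^ c) = sgn b * sgn c := by
  cases b <;> cases c <;> simp [sgn]

/-- Action of `A ⊗ 1` on a vector: `((A ⊗ 1) v)(i, q) = ∑ⱼ A i j v(j, q)`. [folklore] -/
theorem kronecker_one_mulVec {l p : Type*} [Fintype l] [Fintype p] [DecidableEq p]
    (A : Matrix l l ℂ) (v : l × p → ℂ) (i : l) (q : p) :
    ((A ⊗ₖ (1 : Matrix p p ℂ)) *ᵥ v) (i, q) = ∑ j, A i j * v (j, q) := by
  simp only [Matrix.mulVec, dotProduct, Fintype.sum_prod_type, Matrix.kroneckerMap_apply,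
    Matrix.one_apply, mul_ite, mul_one, mul_zero, ite_mul, zero_mul]
  refine Finset.sum_congr rfl fun j _ => ?_
  rw [Finset.sum_ite_eq]
  simp

/-- The real amplitude of the final state at `|k⟩|b⟩`. [folklore] -/
noncomputable def forrelationAmp (n : ℕ) (w : Fin (2 * 2 ^ n) → Bool) (k : Fin (2 * 2 ^ n)) (b : Bool) : ℝ :=
  (1 / Real.sqrt (2 ^ (n + 1))) * (sgn b / Real.sqrt 2) * ∑ k', mixMatrix n k k' * sgn (w k')

/-- The state after `U₀`: amplitude `(2N)^{-1/2} χ(b)/√2` at `|k⟩|b⟩`. [folklore] -/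
theorem prepMatrix_col (n : ℕ) (k : Fin (2 * 2 ^ n)) (b : Bool) (u : Unit) :
    prepMatrix n (k, b, u) (finCongr (pow_succ' 2 n) 0, true, ()) =
      (((1 / Real.sqrt (2 ^ (n + 1))) * (sgn b / Real.sqrt 2) : ℝ) : ℂ) := by
  unfold prepMatrix
  rw [Matrix.kroneckerMap_apply, Matrix.kroneckerMap_apply, Matrix.map_apply, Matrix.map_apply,
    hadamardBig_apply_zero, Matrix.one_apply_eq]
  have h2 : hadamard2 b true = sgn b / Real.sqrt 2 := by cases b <;> simp [hadamard2, sgn]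
  rw [h2]
  simp only [Complex.ofRealHom_eq_coe, mul_one]
  push_cast
  ring

/-- The final state, computed with plain matrices: `U₁ (O_w (U₀ e_start))` has amplitude
`forrelationAmp n w k b` at `|k⟩|b⟩`. [cite: RazTalJACM2022, §2.2] -/
theorem forrelation_final_pure (n : ℕ) (w : Fin (2 * 2 ^ n) → Bool) (k : Fin (2 * 2 ^ n)) (b : Bool) :
    (mixMatrixC n *ᵥ ((prepMatrix n *ᵥ
        Pi.single ((finCongr (pow_succ' 2 n) 0, true, ()) : Fin (2 * 2 ^ n) × Bool × Unit) 1) ∘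
          queryPerm w)) (k, b, ()) = ((forrelationAmp n w k b : ℝ) : ℂ) := by
  rw [Matrix.mulVec_single_one, mixMatrixC, kronecker_one_mulVec]
  simp only [Function.comp_apply, queryPerm_apply, queryMap_apply, Matrix.col_apply, prepMatrix_col,
    Matrix.map_apply, Complex.ofRealHom_eq_coe, forrelationAmp]
  push_cast
  rw [Finset.mul_sum]
  refine Finset.sum_congr rfl fun k' _ => ?_
  rw [sgn_xor]
  push_cast
  ring

/-- **The final state of the one-query algorithm**: amplitude
`(2N)^{-1/2} · χ(b)/√2 · ∑_{k'} V_{k k'} χ(w_{k'})` at `|k⟩|b⟩` (phase kick-back turns the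
bit-flip query into the phase query `|k'⟩ ↦ χ(w_{k'})|k'⟩`). [cite: RazTalJACM2022, §2.2] -/
theorem finalState_forrelationAlg (n : ℕ) (w : Fin (2 * 2 ^ n) → Bool)
    (s : Fin (2 * 2 ^ n) × Bool × (forrelationAlg n).W) :
    (forrelationAlg n).finalState w s = ((forrelationAmp n w s.1 s.2.1 : ℝ) : ℂ) := by
  simp only [QQueryAlg.finalState, forrelationAlg, Fin.foldl_succ, Fin.foldl_zero, Fin.val_zero,
    if_true, Fin.val_succ, Nat.succ_ne_zero, if_false, queryOracle, Matrix.permMatrix_mulVec]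
  obtain ⟨k, b, u⟩ := s
  cases u
  exact forrelation_final_pure n w k b

/-- Membership in the accepting set: the index register is in the first block. [folklore] -/
theorem mem_accept_forrelationAlg (n : ℕ) (s : Fin (2 * 2 ^ n) × Bool × (forrelationAlg n).W) :
    s ∈ (forrelationAlg n).accept ↔ (splitIndex (2 ^ n) s.1).isLeft = true := Iff.rfl

/-- The workspace of `forrelationAlg` has exactly one basis state. [folklore] -/
theorem card_W_forrelationAlg (n : ℕ) : Fintype.card (forrelationAlg n).W = 1 := rfl

/-- The amplitude on the first block: `(2N)^{-1/2} χ(b)/√2 · ((H_N χ(x))ᵢ + χ(yᵢ))/√2`. [cite: RazTalJACM2022, §2.2] -/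
theorem forrelationAmp_xIdx (n : ℕ) (w : Fin (2 * 2 ^ n) → Bool) (i : Fin (2 ^ n)) (b : Bool) :
    forrelationAmp n w (xIdx n i) b = (1 / Real.sqrt (2 ^ (n + 1))) * (sgn b / Real.sqrt 2) *
      ((((hadamardMatrix n).mulVec (fun i' => sgn (w (xIdx n i'))) i) + sgn (w (yIdx n i))) /
        Real.sqrt 2) := by
  unfold forrelationAmp
  congr 1
  rw [sum_splitIndex]
  simp_rw [mixMatrix_xIdx_xIdx, mixMatrix_xIdx_yIdx]
  simp only [Matrix.mulVec, dotProduct, add_div, Finset.sum_div]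
  congr 1
  · refine Finset.sum_congr rfl fun i' _ => ?_
    ring
  · simp [Finset.sum_ite_eq, ite_mul, div_eq_inv_mul]

/-- Squared amplitude on the first block: `rᵢ² / (8N)`, `rᵢ = (H_N χ(x))ᵢ + χ(yᵢ)`. [cite: RazTalJACM2022, §2.2] -/
theorem forrelationAmp_xIdx_sq (n : ℕ) (w : Fin (2 * 2 ^ n) → Bool) (i : Fin (2 ^ n)) (b : Bool) :
    forrelationAmp n w (xIdx n i) b ^ 2 =
      (((hadamardMatrix n).mulVec (fun i' => sgn (w (xIdx n i'))) i) + sgn (w (yIdx n i))) ^ 2 /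
        (8 * 2 ^ n) := by
  rw [forrelationAmp_xIdx]
  have hs : sgn b ^ 2 = 1 := by cases b <;> simp [sgn]
  have h2 : Real.sqrt 2 ^ 2 = 2 := Real.sq_sqrt (by norm_num)
  have hN : Real.sqrt (2 ^ (n + 1)) ^ 2 = 2 ^ (n + 1) := Real.sq_sqrt (by positivity)
  rw [mul_pow, mul_pow, div_pow, div_pow, div_pow, hs, h2, hN, one_pow, pow_succ]
  field_simp
  ring

/-- `∑ᵢ rᵢ² = 2N (1 + φ)`: `‖H χ(x)‖² = ‖χ(x)‖² = N`, `‖χ(y)‖² = N`, cross term `2N φ`. [cite: RazTalJACM2022, §6] -/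
theorem sum_sq_mix (n : ℕ) (w : Fin (2 * 2 ^ n) → Bool) :
    ∑ i, (((hadamardMatrix n).mulVec (fun i' => sgn (w (xIdx n i'))) i) + sgn (w (yIdx n i))) ^ 2 =
      2 ^ n * (2 + 2 * forrelationPhi n (fun k => sgn (w k))) := by
  set sx : Fin (2 ^ n) → ℝ := fun i' => sgn (w (xIdx n i')) with hsx
  have hexp : ∀ i, ((hadamardMatrix n).mulVec sx i + sgn (w (yIdx n i))) ^ 2 =
      (hadamardMatrix n).mulVec sx i * (hadamardMatrix n).mulVec sx i +
        sgn (w (yIdx n i)) * sgn (w (yIdx n i)) +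
        2 * ((hadamardMatrix n).mulVec sx i * sgn (w (yIdx n i))) := by
    intro i; ring
  simp_rw [hexp, Finset.sum_add_distrib, ← Finset.mul_sum]
  have h1 : ∑ i, (hadamardMatrix n).mulVec sx i * (hadamardMatrix n).mulVec sx i = 2 ^ n := by
    have h := dotProduct_hadamard_mulVec n sx
    simp only [dotProduct] at h
    rw [h]
    simp [hsx]
  have h2 : ∑ i : Fin (2 ^ n), sgn (w (yIdx n i)) * sgn (w (yIdx n i)) = 2 ^ n := by simp
  have h3 : ∑ i, (hadamardMatrix n).mulVec sx i * sgn (w (yIdx n i)) =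
      2 ^ n * forrelationPhi n (fun k => sgn (w k)) := by
    unfold forrelationPhi
    rw [mul_div_cancel₀ _ (by positivity)]
    simp only [Matrix.mulVec, dotProduct, Finset.sum_mul, hsx]
    rw [Finset.sum_comm]
    refine Finset.sum_congr rfl fun a _ => Finset.sum_congr rfl fun b _ => ?_
    rw [show hadamardMatrix n b a = hadamardMatrix n a b from by
      simp [hadamardMatrix, hadamardSign_comm n a b]]
    ring
  rw [h1, h2, h3]
  ring

/-- **The one-query algorithm accepts with probability `(1 + φ(x, y))/2`** (Raz–Tal, §6, after
Aaronson–Ambainis, STOC 2015, Prop. 6), in H21's query model. [cite: RazTalJACM2022, §6] -/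
theorem acceptProb_forrelationAlg (n : ℕ) (w : Fin (2 * 2 ^ n) → Bool) :
    (forrelationAlg n).acceptProb w = (1 + forrelationPhi n (fun k => sgn (w k))) / 2 := by
  classical
  simp only [QQueryAlg.acceptProb, finalState_forrelationAlg, Complex.norm_real, Real.norm_eq_abs,
    sq_abs]
  rw [Finset.sum_filter, Fintype.sum_prod_type]
  simp_rw [mem_accept_forrelationAlg]
  rw [sum_splitIndex]
  simp only [splitIndex_xIdx, splitIndex_yIdx, Sum.isLeft_inl, Sum.isLeft_inr, if_true,
    Bool.false_eq_true, if_false, Finset.sum_const_zero, add_zero]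
  simp only [Finset.sum_const, Finset.card_univ, forrelationAmp_xIdx_sq]
  have hcard : Fintype.card (Bool × (forrelationAlg n).W) = 2 := rfl
  simp only [hcard, nsmul_eq_mul, Nat.cast_ofNat]
  rw [← Finset.mul_sum, ← Finset.sum_div, sum_sq_mix]
  field_simp
  ring

end OneQuery

/-! ### Corollary 6.4 reduced to the one-query algorithm and the truncation estimate -/

/-- `φ` is integrable against `𝒢'`. [folklore] -/
theorem integrable_forrelationPhi (n : ℕ) : Integrable (forrelationPhi n) (razTalGaussian n) := by
  unfold forrelationPhi
  refine Integrable.div_const (integrable_finsetSum _ fun i _ => integrable_finsetSum _ fun j _ => ?_) _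
  have h : (fun z : Fin (2 * 2 ^ n) → ℝ => z (xIdx n i) * hadamardMatrix n i j * z (yIdx n j)) =
      fun z => hadamardMatrix n i j * (z (xIdx n i) * z (yIdx n j)) := by
    funext z; ring
  rw [h]
  exact (integrable_mul_razTalGaussian n _ _).const_mul _

/-- `φ ∘ trnc` is integrable against `𝒢'`. [folklore] -/
theorem integrable_forrelationPhi_trnc (n : ℕ) :
    Integrable (fun z : Fin (2 * 2 ^ n) → ℝ => forrelationPhi n (fun k => trnc (z k))) (razTalGaussian n) := by
  unfold forrelationPhi
  refine Integrable.div_const (integrable_finsetSum _ fun i _ => integrable_finsetSum _ fun j _ => ?_) _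
  have h : (fun z : Fin (2 * 2 ^ n) → ℝ =>
      trnc (z (xIdx n i)) * hadamardMatrix n i j * trnc (z (yIdx n j))) =
      fun z => hadamardMatrix n i j * (trnc (z (xIdx n i)) * trnc (z (yIdx n j))) := by
    funext z; ring
  rw [h]
  exact (integrable_trnc_mul_trnc n _ _).const_mul _

/-- **The one-query Forrelation algorithm** (Raz–Tal, §6, quoting Aaronson–Ambainis, STOC 2015,
Prop. 6): "on a given input `x, y ∈ {±1}^N` the algorithm `Q` accepts with probability
`(1 + φ(x, y))/2`", `Q` making a single query. Stated in H21's model `QQueryAlg` on `2N`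
input bits read through `sgn`; PROVED below (`razTal2022_oneQueryAlg_holds`) by the explicit
algorithm `forrelationAlg` (uniform superposition with target `|−⟩`, one bit-flip query = phase
query, the mixing unitary `V ⊗ 1`, acceptance on the first block). Kept as a named `Prop` so
that users can be fed `_holds`. [cite: RazTalJACM2022, §6] -/
def RazTal2022_oneQueryAlg : Prop :=
  ∀ n : ℕ, ∃ A : QQueryAlg (2 * 2 ^ n), A.queries = 1 ∧
    ∀ w : Fin (2 * 2 ^ n) → Bool, A.acceptProb w = (1 + forrelationPhi n (fun k => sgn (w k))) / 2

/-- **The one-query fact holds**: witnessed by `forrelationAlg` (`acceptProb_forrelationAlg`). [cite: RazTalJACM2022, §6] -/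
theorem razTal2022_oneQueryAlg_holds : RazTal2022_oneQueryAlg :=
  fun n => ⟨forrelationAlg n, rfl, acceptProb_forrelationAlg n⟩

/-- **Truncation costs little for `φ`** (Raz–Tal, proof of Claim 6.3, from Claim 5.3 with
`p₀ = 0`, `p = 1`, `z₀ = 0`): for `n` sufficiently large,
`𝔼_{(x,y)∼𝒢'}[|φ(trnc x, trnc y) − φ(x, y)|] ≤ 8 · N^{-2}`. [cite: RazTalJACM2022, Claim 6.3] -/
def RazTal2022_truncation_phi : Prop :=
  ∃ n₀ : ℕ, ∀ n : ℕ, n₀ ≤ n →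
    ∫ z, |forrelationPhi n (fun k => trnc (z k)) - forrelationPhi n z| ∂(razTalGaussian n) ≤
      8 / ((2 ^ n : ℕ) : ℝ) ^ 2

/-- `8 N^{-2} ≤ ε/2` once `N = 2ⁿ ≥ 512` (the numerical step in the proof of Claim 6.3). [cite: RazTalJACM2022, Claim 6.3] -/
theorem eight_div_sq_le_half_eps {n : ℕ} (hn : 9 ≤ n) :
    8 / ((2 ^ n : ℕ) : ℝ) ^ 2 ≤ razTalEps (2 ^ n) / 2 := by
  have hN : (512 : ℝ) ≤ (2 ^ n : ℕ) := by
    exact_mod_cast le_trans (by norm_num : 512 ≤ 2 ^ 9) (Nat.pow_le_pow_right (by norm_num) hn)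
  have hNpos : (0 : ℝ) < (2 ^ n : ℕ) := by linarith
  have hlog : Real.log (2 ^ n : ℕ) ≤ (2 ^ n : ℕ) :=
    (Real.log_le_sub_one_of_pos hNpos).trans (by linarith)
  have hlogpos : 0 < Real.log (2 ^ n : ℕ) := Real.log_pos (by linarith)
  unfold razTalEps
  rw [div_div, div_le_div_iff₀ (by positivity) (by positivity)]
  nlinarith

/-- **Corollary 6.4 from its two ingredients** (Raz–Tal, §6: Claims 6.1, 6.2, Eq. (2) — proved
above — together with the one-query algorithm of [AA15, Prop. 6] and the truncation estimate of
Claim 6.3, here the named facts `RazTal2022_oneQueryAlg` and `RazTal2022_truncation_phi`). [cite: RazTalJACM2022, Cor. 6.4] -/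
theorem razTal2022_cor64_of (hQ : RazTal2022_oneQueryAlg) (hT : RazTal2022_truncation_phi) :
    RazTal2022_cor64 := by
  obtain ⟨n₁, hT⟩ := hT
  refine ⟨max n₁ 9, fun n hn => ?_⟩
  have hn₁ : n₁ ≤ n := (le_max_left _ _).trans hn
  have hn9 : 9 ≤ n := (le_max_right _ _).trans hn
  obtain ⟨A, hA1, hacc⟩ := hQ n
  refine ⟨A, hA1, ?_⟩
  simp_rw [hacc]
  -- the `𝒟`-average of the acceptance probability
  have hD : ∑ w, (razTalDistribution n w).toReal *
      ((1 + forrelationPhi n (fun k => sgn (w k))) / 2) =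
      1 / 2 + (∫ z, forrelationPhi n (fun k => trnc (z k)) ∂(razTalGaussian n)) / 2 := by
    have hw : ∀ w : Fin (2 * 2 ^ n) → Bool, (razTalDistribution n w).toReal *
        ((1 + forrelationPhi n (fun k => sgn (w k))) / 2) =
        (razTalDistribution n w).toReal / 2 +
          (razTalDistribution n w).toReal * forrelationPhi n (fun k => sgn (w k)) / 2 := by
      intro w; ring
    simp_rw [hw]
    rw [Finset.sum_add_distrib, ← Finset.sum_div, ← Finset.sum_div, sum_toReal_eq_one,
      sum_razTalDistribution_forrelationPhi]
  -- the uniform average of the acceptance probability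
  have hU : (∑ w : Fin (2 * 2 ^ n) → Bool, (1 + forrelationPhi n (fun k => sgn (w k))) / 2) /
      2 ^ (2 * 2 ^ n) = 1 / 2 := by
    rw [← Finset.sum_div, Finset.sum_add_distrib, sum_forrelationPhi_sgn, add_zero, Finset.sum_const,
      Finset.card_univ, Fintype.card_fun, Fintype.card_bool, Fintype.card_fin, nsmul_eq_mul, mul_one]
    push_cast
    field_simp
  rw [hD, hU]
  -- the Gaussian estimate: `∫ φ ∘ trnc ≥ ε - 8/N²`
  have hI : razTalEps (2 ^ n) - 8 / ((2 ^ n : ℕ) : ℝ) ^ 2 ≤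
      ∫ z, forrelationPhi n (fun k => trnc (z k)) ∂(razTalGaussian n) := by
    have h1 := integral_sub (integrable_forrelationPhi_trnc n) (integrable_forrelationPhi n)
    have h2 := abs_integral_le_integral_abs
      (f := fun z => forrelationPhi n (fun k => trnc (z k)) - forrelationPhi n z) (μ := razTalGaussian n)
    have h3 := hT n hn₁
    have h4 := neg_abs_le (∫ z, (forrelationPhi n (fun k => trnc (z k)) - forrelationPhi n z) ∂(razTalGaussian n))
    rw [integral_forrelationPhi] at h1
    linarith
  have hsmall := eight_div_sq_le_half_eps hn9
  rw [show 1 / 2 + (∫ z, forrelationPhi n (fun k => trnc (z k)) ∂(razTalGaussian n)) / 2 - 1 / 2 =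
      (∫ z, forrelationPhi n (fun k => trnc (z k)) ∂(razTalGaussian n)) / 2 by ring]
  refine le_trans ?_ (le_abs_self _)
  linarith

/-- **Corollary 6.4 from the truncation estimate alone** (the one-query half being proved). [cite: RazTalJACM2022, Cor. 6.4] -/
theorem razTal2022_cor64_of_truncation (hT : RazTal2022_truncation_phi) : RazTal2022_cor64 :=
  razTal2022_cor64_of razTal2022_oneQueryAlg_holds hT

/-! ### The small-`n` patch: reading one bit with one query -/

/-- The one-query algorithm that queries bit `i₀` into the target qubit and accepts iff it is
set (all unitaries the identity). Used to cover the finitely many `n` below the threshold of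
Raz–Tal's "`n` sufficiently large" (§4). [folklore] -/
def readBitAlg (M : ℕ) (i₀ : Fin M) : QQueryAlg M where
  W := Unit
  queries := 1
  unitaries := fun _ => 1
  start := (i₀, false, ())
  accept := {s | s.2.1 = true}

/-- The workspace of `readBitAlg` is a single basis state. [folklore] -/
instance (M : ℕ) (i₀ : Fin M) : Subsingleton (readBitAlg M i₀).W :=
  inferInstanceAs (Subsingleton Unit)

/-- The accepting basis states of `readBitAlg` are those with target qubit set. [folklore] -/
theorem mem_accept_readBitAlg (M : ℕ) (i₀ : Fin M) (s : Fin M × Bool × (readBitAlg M i₀).W) :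
    s ∈ (readBitAlg M i₀).accept ↔ s.2.1 = true := Iff.rfl

/-- The final state of `readBitAlg` on `x` is the basis state `|i₀, x_{i₀}⟩`. [folklore] -/
theorem finalState_readBitAlg (M : ℕ) (i₀ : Fin M) (x : Fin M → Bool)
    (s : Fin M × Bool × (readBitAlg M i₀).W) :
    (readBitAlg M i₀).finalState x s = if s.1 = i₀ ∧ s.2.1 = x i₀ then 1 else 0 := by
  simp only [QQueryAlg.finalState, readBitAlg, Fin.foldl_succ, Fin.foldl_zero, OneMemClass.coe_one,
    Matrix.one_mulVec, queryOracle, Matrix.permMatrix_mulVec, Function.comp_apply, queryPerm_apply,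
    queryMap_apply]
  obtain ⟨i, b, u⟩ := s
  cases u
  by_cases hi : i = i₀
  · subst hi
    cases b <;> cases hx : x i <;> simp_all
  · simp [hi]

/-- `readBitAlg` accepts `x` with probability `1` if `x_{i₀}` is set and `0` otherwise. [folklore] -/
theorem acceptProb_readBitAlg (M : ℕ) (i₀ : Fin M) (x : Fin M → Bool) :
    (readBitAlg M i₀).acceptProb x = if x i₀ then 1 else 0 := by
  classical
  simp only [QQueryAlg.acceptProb, finalState_readBitAlg]
  rw [Finset.sum_filter, Fintype.sum_eq_single (i₀, x i₀, (readBitAlg M i₀).start.2.2)]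
  · simp [mem_accept_readBitAlg]
  · intro s hs
    obtain ⟨i, b, u⟩ := s
    have hu : u = (readBitAlg M i₀).start.2.2 := Subsingleton.elim _ _
    subst hu
    by_cases h : i = i₀ ∧ b = x i₀
    · exact absurd (by rw [h.1, h.2]) hs
    · simp [h]

/-- Averaging against a Dirac mass evaluates: `∑_x δ_a(x) g(x) = g(a)`. [folklore] -/
theorem sum_toReal_pure_mul {α : Type*} [Fintype α] (a : α) (g : α → ℝ) :
    ∑ x, (PMF.pure a x).toReal * g x = g a := by
  classical
  rw [Finset.sum_eq_single_of_mem a (Finset.mem_univ a)]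
  · simp
  · intro b _ hb; simp [PMF.pure_apply, hb]

/-- Exactly half of all inputs have bit `i₀` set: `∑_x [x_{i₀}] = 2^M / 2`. [folklore] -/
theorem sum_indicator_bit (M : ℕ) (i₀ : Fin M) :
    (∑ x : Fin M → Bool, (if x i₀ then (1 : ℝ) else 0)) = 2 ^ M / 2 := by
  -- flipping bit `i₀` is an involution exchanging the two halves
  set e : (Fin M → Bool) → (Fin M → Bool) := fun x => Function.update x i₀ (!x i₀) with he
  have hinv : Function.Involutive e := by
    intro x
    simp only [he]
    ext j
    by_cases hj : j = i₀
    · subst hj; simp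
    · simp [Function.update_of_ne hj]
  have hsum := Function.Bijective.sum_comp hinv.bijective (fun x => if x i₀ then (1 : ℝ) else 0)
  have hflip : ∀ x, (if e x i₀ then (1 : ℝ) else 0) = 1 - (if x i₀ then (1 : ℝ) else 0) := by
    intro x
    simp only [he, Function.update_self]
    cases x i₀ <;> simp
  simp only [hflip, Finset.sum_sub_distrib, Finset.sum_const, Finset.card_univ, Fintype.card_fun,
    Fintype.card_bool, Fintype.card_fin, nsmul_eq_mul, mul_one] at hsum
  push_cast at hsum
  linarith

/-! ### Assembly: Theorem 1.1 (Cor 6.4 + Thm 7.4) implies **quantum-advantage.S15** -/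

/-- `ln N ≥ ln 2 > 1/2` for `N = 2ⁿ`, `n ≥ 1`. [folklore] -/
theorem half_lt_log_two_pow {n : ℕ} (hn : 1 ≤ n) : (1 : ℝ) / 2 < Real.log (2 ^ n : ℕ) := by
  have h2 : Real.log 2 ≤ Real.log (2 ^ n : ℕ) := by
    apply Real.log_le_log (by norm_num)
    exact_mod_cast Nat.le_self_pow (by omega) 2 |>.trans_eq' (by simp)
  have := Real.log_two_gt_d9
  linarith

/-- **Assembly of quantum-advantage.S15 from Raz–Tal's two halves** (Raz–Tal, §8.1: "the first
part of the theorem is Corollary 6.4, the second part is Corollary 7.5", Cor 7.5 being Thm 7.4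
with constants absorbed). Given the named facts `RazTal2022_thm74` and `RazTal2022_cor64`, the
vendored statement `raz_tal_forrelation` holds, with `𝒟 = razTalDistribution n` for large `n`
and the Dirac/`readBitAlg` patch for the finitely many small `n`. [cite: RazTalJACM2022, §8.1] -/
theorem raz_tal_forrelation_of_thm74_cor64 (h74 : RazTal2022_thm74) (h64 : RazTal2022_cor64) :
    raz_tal_forrelation := by
  obtain ⟨c₁, hc₁, n₁, h74⟩ := h74
  obtain ⟨n₂, h64⟩ := h64
  -- the constants
  set n₀ : ℕ := max n₁ n₂ with hn₀
  set C : ℕ := max (max 32 ⌈c₁⌉₊) n₀ with hC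
  have hC32 : (32 : ℝ) ≤ C := by exact_mod_cast (le_max_left _ _).trans (le_max_left _ _)
  have hCc₁ : c₁ ≤ C := (Nat.le_ceil c₁).trans
    (by exact_mod_cast (le_max_right _ _).trans (le_max_left _ _))
  have hCn₀ : n₀ ≤ C := le_max_right _ _
  refine ⟨C, 1 / 96, by norm_num, ?_⟩
  intro n N hn hN
  subst hN
  -- elementary facts about `N = 2ⁿ`
  have hlog : (1 : ℝ) / 2 < Real.log (2 ^ n : ℕ) := half_lt_log_two_pow hn
  have hlog_pos : 0 < Real.log (2 ^ n : ℕ) := by linarith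
  have hsqrt_pos : 0 < Real.sqrt (2 ^ n : ℕ) := Real.sqrt_pos.2 (by positivity)
  -- `(C log s)^{C(d+1)} ≥ 16^{e}` bounds, for `s ≥ 2`
  have hCL : ∀ s : ℕ, 2 ≤ s → (16 : ℝ) ≤ C * Real.log s := by
    intro s hs
    have hls : (1 : ℝ) / 2 < Real.log s := by
      have h2 : Real.log 2 ≤ Real.log s := Real.log_le_log (by norm_num) (by exact_mod_cast hs)
      have := Real.log_two_gt_d9
      linarith
    nlinarith
  by_cases hlarge : n₀ ≤ n
  · -- large `n`: the Raz–Tal distribution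
    refine ⟨razTalDistribution n, ?_, ?_⟩
    · intro F d s hF hd hsz hs
      refine (h74 n ((le_max_left _ _).trans hlarge) F d s hF hd hsz hs).trans ?_
      refine div_le_div_of_nonneg_right ?_ hsqrt_pos.le
      have hL := hCL s hs
      have hCL1 : (1 : ℝ) ≤ C * Real.log s := by linarith
      have hε0 : 0 ≤ razTalEps (2 ^ n) := by unfold razTalEps; positivity
      have hε1 : razTalEps (2 ^ n) ≤ 1 := by
        unfold razTalEps
        rw [div_le_one (by positivity)]
        linarith
      have hlogs : 0 ≤ Real.log s := Real.log_natCast_nonneg s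
      calc 16 * razTalEps (2 ^ n) * (c₁ * Real.log s) ^ (2 * (d - 1))
          ≤ 16 * 1 * (C * Real.log s) ^ (2 * (d - 1)) := by
            gcongr
        _ ≤ (C * Real.log s) * (C * Real.log s) ^ (2 * (d - 1)) := by
            rw [mul_one]; gcongr
        _ = (C * Real.log s) ^ (2 * (d - 1) + 1) := by ring
        _ ≤ (C * Real.log s) ^ (C * (d + 1)) := by
            apply pow_le_pow_right₀ hCL1
            have hC2 : (2 : ℕ) ≤ C := by
              have : (32 : ℕ) ≤ C := by exact_mod_cast hC32
              omega
            calc 2 * (d - 1) + 1 ≤ 2 * (d + 1) := by omega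
              _ ≤ C * (d + 1) := Nat.mul_le_mul_right _ hC2
    · obtain ⟨A, hA, hadv⟩ := h64 n ((le_max_right _ _).trans hlarge)
      refine ⟨A, hA, le_trans (le_of_eq ?_) hadv⟩
      unfold razTalEps
      field_simp
      ring
  · -- small `n`: Dirac at the all-`true` input and the bit-reading algorithm
    push Not at hlarge
    have hM : 0 < 2 * 2 ^ n := by positivity
    set i₀ : Fin (2 * 2 ^ n) := ⟨0, hM⟩
    refine ⟨PMF.pure fun _ => true, ?_, ?_⟩
    · intro F d s hF hd hsz hs
      -- the left-hand side is at most `1`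
      have hlhs : |∑ w, (PMF.pure (fun _ : Fin (2 * 2 ^ n) => true) w).toReal *
            (if F.eval w then (1 : ℝ) else 0) -
          (∑ w : Fin (2 * 2 ^ n) → Bool, if F.eval w then (1 : ℝ) else 0) / 2 ^ (2 * 2 ^ n)| ≤ 1 := by
        have h1 : ∑ w, (PMF.pure (fun _ : Fin (2 * 2 ^ n) => true) w).toReal *
            (if F.eval w then (1 : ℝ) else 0) = if F.eval (fun _ => true) then (1 : ℝ) else 0 :=
          sum_toReal_pure_mul _ _
        rw [h1, abs_le]
        have hs0 : 0 ≤ (∑ w : Fin (2 * 2 ^ n) → Bool, if F.eval w then (1 : ℝ) else 0) :=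
          Finset.sum_nonneg fun w _ => by split_ifs <;> norm_num
        have hs1 : (∑ w : Fin (2 * 2 ^ n) → Bool, if F.eval w then (1 : ℝ) else 0) ≤
            2 ^ (2 * 2 ^ n) := by
          calc (∑ w : Fin (2 * 2 ^ n) → Bool, if F.eval w then (1 : ℝ) else 0)
              ≤ ∑ _w : Fin (2 * 2 ^ n) → Bool, (1 : ℝ) :=
                Finset.sum_le_sum fun w _ => by split_ifs <;> norm_num
            _ = 2 ^ (2 * 2 ^ n) := by simp
        have hq0 : 0 ≤ (∑ w : Fin (2 * 2 ^ n) → Bool, if F.eval w then (1 : ℝ) else 0) /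
            2 ^ (2 * 2 ^ n) := by positivity
        have hq1 : (∑ w : Fin (2 * 2 ^ n) → Bool, if F.eval w then (1 : ℝ) else 0) /
            2 ^ (2 * 2 ^ n) ≤ 1 := by
          rw [div_le_one (by positivity)]; exact hs1
        constructor <;> split_ifs <;> linarith
      refine hlhs.trans ?_
      rw [le_div_iff₀ hsqrt_pos, one_mul]
      have hL := hCL s hs
      calc Real.sqrt (2 ^ n : ℕ) ≤ (2 ^ n : ℕ) := by
            rw [Real.sqrt_le_left]
            · exact_mod_cast Nat.le_self_pow two_ne_zero _
            · positivity
        _ ≤ (2 : ℝ) ^ C := by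
            push_cast
            exact pow_le_pow_right₀ (by norm_num) (hlarge.le.trans hCn₀)
        _ ≤ (C * Real.log s) ^ C := by
            gcongr; linarith
        _ ≤ (C * Real.log s) ^ (C * (d + 1)) := by
            apply pow_le_pow_right₀ (by linarith)
            exact Nat.le_mul_of_pos_right C (Nat.succ_pos d)
    · refine ⟨readBitAlg (2 * 2 ^ n) i₀, rfl, ?_⟩
      have h1 : ∑ w, (PMF.pure (fun _ : Fin (2 * 2 ^ n) => true) w).toReal *
          (readBitAlg (2 * 2 ^ n) i₀).acceptProb w = 1 := by
        rw [sum_toReal_pure_mul, acceptProb_readBitAlg]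
        simp
      have h2 : (∑ w : Fin (2 * 2 ^ n) → Bool, (readBitAlg (2 * 2 ^ n) i₀).acceptProb w) /
          2 ^ (2 * 2 ^ n) = 1 / 2 := by
        simp only [acceptProb_readBitAlg, sum_indicator_bit]
        field_simp
      rw [h1, h2]
      have h3 : 1 / 96 / Real.log (2 ^ n : ℕ) ≤ 1 / 2 := by
        rw [div_le_iff₀ hlog_pos]
        linarith
      refine h3.trans ?_
      norm_num

/-- **quantum-advantage.S15 from Theorem 7.4 and the truncation estimate of Claim 6.3**: what
remains unproved of Raz–Tal after this file is exactly the AC⁰ side (Thm 7.4, resting on Tal's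
Lemma 7.1) and the Gaussian tail estimate `𝔼|φ ∘ trnc − φ| ≤ 8N⁻²`. [cite: RazTalJACM2022, §8.1] -/
theorem raz_tal_forrelation_of_thm74_truncation (h74 : RazTal2022_thm74)
    (hT : RazTal2022_truncation_phi) : raz_tal_forrelation :=
  raz_tal_forrelation_of_thm74_cor64 h74 (razTal2022_cor64_of_truncation hT)

open scoped NNReal

/-! ### Both halves of `𝒢'` are `𝒩(0, ε I_N)` (Raz–Tal, §4.1) -/

section BlockLaws

open WithLp

/-- **Rotation invariance of `𝒩(0, I)`**: an orthogonal matrix `Q` (`Qᵀ Q = I`) preserves the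
product standard Gaussian, `Q_* 𝒩(0, I) = 𝒩(0, I)`. Obtained from Mathlib's basis independence
of `stdGaussian` (`stdGaussian_eq_map_pi_orthonormalBasis`, applied to the orthonormal basis of
columns of `Q`) transported along `toLp 2 / ofLp`. [folklore] -/
theorem pi_gaussianReal_map_mulVec {ι : Type*} [Fintype ι] [DecidableEq ι]
    (Q : Matrix ι ι ℝ) (hQ : Q.transpose * Q = 1) :
    (Measure.pi fun _ : ι => gaussianReal 0 1).map Q.mulVec =
      Measure.pi fun _ : ι => gaussianReal 0 1 := by
  classical
  cases isEmpty_or_nonempty ι with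
  | inl h =>
    have : Q.mulVec = id := by
      funext x; funext i; exact (IsEmpty.false i).elim
    rw [this, Measure.map_id]
  | inr h =>
  -- the columns of `Q` as an orthonormal family of `EuclideanSpace ℝ ι`
  set v : ι → EuclideanSpace ℝ ι := fun i => toLp 2 (fun j => Q j i) with hv
  have hon : Orthonormal ℝ v := by
    rw [orthonormal_iff_ite]
    intro i j
    rw [hv, EuclideanSpace.inner_toLp_toLp]
    have h := congrFun (congrFun hQ j) i
    rw [Matrix.mul_apply, Matrix.one_apply] at h
    simp only [Matrix.transpose_apply] at h
    rw [dotProduct]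
    simp only [star_trivial]
    rw [h]
    by_cases hij : i = j
    · simp [hij]
    · simp [hij, Ne.symm hij]
  have hcard : Fintype.card ι = Module.finrank ℝ (EuclideanSpace ℝ ι) := by simp
  set b : OrthonormalBasis ι ℝ (EuclideanSpace ℝ ι) :=
    (basisOfOrthonormalOfCardEqFinrank hon hcard).toOrthonormalBasis
      (by rw [coe_basisOfOrthonormalOfCardEqFinrank]; exact hon) with hb
  have hbv : ∀ i, b i = v i := by
    intro i
    rw [hb, Module.Basis.coe_toOrthonormalBasis, coe_basisOfOrthonormalOfCardEqFinrank]
  have h1 := stdGaussian_eq_map_pi_orthonormalBasis b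
  rw [← map_pi_eq_stdGaussian] at h1
  -- `∑ i, x i • b i = toLp 2 (Q.mulVec x)`
  have hsum : (fun x : ι → ℝ => ∑ i, x i • b i) = toLp 2 ∘ Q.mulVec := by
    funext x
    simp only [Function.comp_apply, hbv, hv]
    apply PiLp.ext
    intro j
    simp only [WithLp.ofLp_sum, WithLp.ofLp_smul, Finset.sum_apply, Pi.smul_apply, smul_eq_mul,
      Matrix.mulVec, dotProduct]
    exact Finset.sum_congr rfl fun i _ => mul_comm _ _
  rw [hsum] at h1
  have h2 := congrArg (fun m => Measure.map (ofLp : EuclideanSpace ℝ ι → ι → ℝ) m) h1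
  simp only at h2
  rw [Measure.map_map (WithLp.measurable_ofLp 2 _) (WithLp.measurable_toLp 2 _),
    Measure.map_map (WithLp.measurable_ofLp 2 _) ((WithLp.measurable_toLp 2 _).comp
      (Continuous.measurable (by fun_prop)))] at h2
  have e1 : (ofLp : EuclideanSpace ℝ ι → ι → ℝ) ∘ toLp 2 = id := by funext x; rfl
  have e2 : (ofLp : EuclideanSpace ℝ ι → ι → ℝ) ∘ (toLp 2 ∘ Q.mulVec) = Q.mulVec := by funext x; rfl
  rw [e1, e2, Measure.map_id] at h2
  exact h2.symm

/-- `H_N` preserves `𝒩(0, I_N)`: `y = H_N x ∼ 𝒩(0, I_N)` for `x ∼ 𝒩(0, I_N)` (Raz–Tal, §4.1: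
"`y ∼ 𝒩(0, I_N)` ... `G` is symmetric in `x` and `y`"). [cite: RazTalJACM2022, §4.1] -/
theorem stdGaussianPi_map_hadamard (n : ℕ) :
    (stdGaussianPi (2 ^ n)).map (hadamardMatrix n).mulVec = stdGaussianPi (2 ^ n) := by
  unfold stdGaussianPi
  apply pi_gaussianReal_map_mulVec
  rw [hadamardMatrix_transpose, hadamardMatrix_mul_self]

/-- `ε` as a nonnegative real (the variance parameter of `gaussianReal`). [cite: RazTalJACM2022, §4.2] -/
noncomputable def razTalEpsNN (n : ℕ) : ℝ≥0 := ⟨razTalEps (2 ^ n), razTalEps_nonneg _⟩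

/-- `(razTalEpsNN n : ℝ) = ε`. [cite: RazTalJACM2022, §4.2] -/
@[simp] theorem coe_razTalEpsNN (n : ℕ) : (razTalEpsNN n : ℝ) = razTalEps (2 ^ n) := rfl

/-- The common law `𝒩(0, ε I_N) = 𝒩(0, ε)^{⊗N}` of each half of `z = (x, y) ∼ 𝒢'`
(Raz–Tal, §4.1–4.2: "`x₁, …, x_N` are independent ... similarly `y₁, …, y_N` are independent",
each `𝒩(0, ε)`). [cite: RazTalJACM2022, §4.1] -/
noncomputable def blockGaussian (n : ℕ) : Measure (Fin (2 ^ n) → ℝ) :=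
  Measure.pi fun _ => gaussianReal 0 (razTalEpsNN n)

/-- `𝒩(0, ε I_N)` is a probability measure. [folklore] -/
instance (n : ℕ) : IsProbabilityMeasure (blockGaussian n) := by
  unfold blockGaussian; infer_instance

/-- Scaling `𝒩(0, I_N)` by `√ε` coordinatewise gives `𝒩(0, ε I_N)`. [folklore] -/
theorem stdGaussianPi_map_smul (n : ℕ) :
    (stdGaussianPi (2 ^ n)).map (fun x i => Real.sqrt (razTalEps (2 ^ n)) * x i) =
      blockGaussian n := by
  unfold stdGaussianPi blockGaussian
  rw [Measure.pi_map_pi (f := fun (_ : Fin (2 ^ n)) (t : ℝ) => Real.sqrt (razTalEps (2 ^ n)) * t)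
    fun _ => by fun_prop]
  congr 1
  funext i
  rw [gaussianReal_map_const_mul, mul_zero, mul_one]
  congr 1
  ext
  simp [Real.sq_sqrt (razTalEps_nonneg _)]

/-- The `x`-half of the sample map is `x ↦ √ε x`. [cite: RazTalJACM2022, §4.2] -/
theorem xBlock_comp_razTalSample (n : ℕ) :
    (fun (z : Fin (2 * 2 ^ n) → ℝ) (i : Fin (2 ^ n)) => z (xIdx n i)) ∘ razTalSample n =
      fun x i => Real.sqrt (razTalEps (2 ^ n)) * x i := by
  funext x; funext i
  simp [razTalSample]

/-- The `y`-half of the sample map is `x ↦ √ε H_N x`. [cite: RazTalJACM2022, §4.2] -/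
theorem yBlock_comp_razTalSample (n : ℕ) :
    (fun (z : Fin (2 * 2 ^ n) → ℝ) (j : Fin (2 ^ n)) => z (yIdx n j)) ∘ razTalSample n =
      (fun x i => Real.sqrt (razTalEps (2 ^ n)) * x i) ∘ (hadamardMatrix n).mulVec := by
  funext x; funext j
  simp [razTalSample]

/-- **The `x`-half of `𝒢'` is `𝒩(0, ε I_N)`** (Raz–Tal, §4.1–4.2). [cite: RazTalJACM2022, §4.1] -/
theorem map_xBlock_razTalGaussian (n : ℕ) :
    (razTalGaussian n).map (fun z i => z (xIdx n i)) = blockGaussian n := by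
  rw [razTalGaussian, Measure.map_map (by fun_prop) (continuous_razTalSample n).measurable,
    xBlock_comp_razTalSample, stdGaussianPi_map_smul]

/-- **The `y`-half of `𝒢'` is `𝒩(0, ε I_N)`** (Raz–Tal, §4.1–4.2; uses `H_N H_N = I_N` through
the rotation invariance of `𝒩(0, I_N)`). [cite: RazTalJACM2022, §4.1] -/
theorem map_yBlock_razTalGaussian (n : ℕ) :
    (razTalGaussian n).map (fun z j => z (yIdx n j)) = blockGaussian n := by
  rw [razTalGaussian, Measure.map_map (by fun_prop) (continuous_razTalSample n).measurable,
    yBlock_comp_razTalSample, ← Measure.map_map (by fun_prop) (by fun_prop),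
    stdGaussianPi_map_hadamard, stdGaussianPi_map_smul]

/-- Transfer of integrals to a half: if `z ↦ (z_{e i})_i` pushes `𝒢'` to `𝒩(0, ε I_N)` then
`∫ g((z_{e i})_i) d𝒢' = ∫ g d𝒩(0, ε I_N)`. [folklore] -/
theorem integral_block_razTalGaussian (n : ℕ) {e : Fin (2 ^ n) → Fin (2 * 2 ^ n)}
    (he : (razTalGaussian n).map (fun z i => z (e i)) = blockGaussian n)
    (g : (Fin (2 ^ n) → ℝ) → ℝ) (hg : AEStronglyMeasurable g (blockGaussian n)) :
    ∫ z, g (fun i => z (e i)) ∂(razTalGaussian n) = ∫ x, g x ∂(blockGaussian n) := by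
  have hm : Measurable (fun (z : Fin (2 * 2 ^ n) → ℝ) (i : Fin (2 ^ n)) => z (e i)) :=
    measurable_pi_lambda _ fun i => measurable_pi_apply (e i)
  rw [← he, integral_map hm.aemeasurable]
  rwa [he]

/-- Transfer of integrability to a half. [folklore] -/
theorem integrable_block_razTalGaussian (n : ℕ) {e : Fin (2 ^ n) → Fin (2 * 2 ^ n)}
    (he : (razTalGaussian n).map (fun z i => z (e i)) = blockGaussian n)
    (g : (Fin (2 ^ n) → ℝ) → ℝ) (hg : Integrable g (blockGaussian n)) :
    Integrable (fun z => g (fun i => z (e i))) (razTalGaussian n) := by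
  have hm : Measurable (fun (z : Fin (2 * 2 ^ n) → ℝ) (i : Fin (2 ^ n)) => z (e i)) :=
    measurable_pi_lambda _ fun i => measurable_pi_apply (e i)
  rw [← he] at hg
  exact (integrable_map_measure hg.aestronglyMeasurable hm.aemeasurable).1 hg

end BlockLaws

/-! ### One-dimensional Gaussian tail estimates -/

section Tails

/-- The truncated second moment integrand `t² · 1_{1 < |t|}`. [folklore] -/
noncomputable def sqTail (t : ℝ) : ℝ := if 1 < |t| then t ^ 2 else 0

/-- `t² 1_{1<|t|} ≥ 0`. [folklore] -/
theorem sqTail_nonneg (t : ℝ) : 0 ≤ sqTail t := by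
  unfold sqTail; split_ifs <;> positivity

/-- Exponential domination of the tail integrand: `t² 1_{1<|t|} ≤ e^{ut-u} + e^{-ut-u}` for
`u ≥ 2` (from `s ≤ e^{s-1}`). [folklore] -/
theorem sqTail_le_exp (u t : ℝ) (hu : 2 ≤ u) :
    sqTail t ≤ Real.exp (u * t - u) + Real.exp ((-u) * t - u) := by
  have key : ∀ s : ℝ, 1 < s → s ^ 2 ≤ Real.exp (u * s - u) := by
    intro s hs
    have h1 : s ≤ Real.exp (s - 1) := by
      have := Real.add_one_le_exp (s - 1); linarith
    have h0 : 0 ≤ s := by linarith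
    calc s ^ 2 ≤ Real.exp (s - 1) ^ 2 := by gcongr
      _ = Real.exp (2 * (s - 1)) := by rw [← Real.exp_nat_mul]; norm_num
      _ ≤ Real.exp (u * s - u) := by
        apply Real.exp_le_exp.2
        nlinarith
  unfold sqTail
  split_ifs with h
  · rcases lt_or_ge 0 t with ht | ht
    · rw [abs_of_pos ht] at h
      have := key t h
      linarith [Real.exp_pos ((-u) * t - u)]
    · rw [abs_of_nonpos ht] at h
      have := key (-t) h
      have e : (-t) ^ 2 = t ^ 2 := by ring
      have e' : u * -t - u = (-u) * t - u := by ring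
      rw [e, e'] at this
      linarith [Real.exp_pos (u * t - u)]
  · positivity

/-- `∫ e^{at - u} d𝒩(0,v) = e^{v a²/2 - u}` (the Gaussian moment generating function,
`mgf_id_gaussianReal`). [folklore] -/
theorem integral_exp_mul_sub_gaussianReal (v : ℝ≥0) (a u : ℝ) :
    ∫ t, Real.exp (a * t - u) ∂(gaussianReal 0 v) = Real.exp (v * a ^ 2 / 2 - u) := by
  have h := congrFun (mgf_id_gaussianReal (μ := 0) (v := v)) a
  simp only [mgf, id_eq, zero_mul, zero_add] at h
  simp_rw [Real.exp_sub]
  rw [integral_div, h]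

/-- `t ↦ e^{at-u}` is `𝒩(0,v)`-integrable. [folklore] -/
theorem integrable_exp_mul_sub_gaussianReal (v : ℝ≥0) (a u : ℝ) :
    Integrable (fun t => Real.exp (a * t - u)) (gaussianReal 0 v) := by
  simp_rw [Real.exp_sub]
  exact (integrable_exp_mul_gaussianReal a).div_const _

/-- **Gaussian tail estimate** (the Chernoff-type bound behind Raz–Tal's
`Pr[|𝒩(0, ε)| ≥ a] ≤ e^{-a²/(2ε)}`, proof of Claim 5.2, in the integrated form used here):
`∫ t² 1_{1<|t|} d𝒩(0,v) ≤ 2 e^{-1/(2v)}` for `0 < v ≤ 1/2`. [cite: RazTalJACM2022, Claim 5.2] -/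
theorem integral_sqTail_gaussianReal_le (v : ℝ≥0) (hv0 : 0 < (v : ℝ)) (hv : (v : ℝ) ≤ 1 / 2) :
    ∫ t, sqTail t ∂(gaussianReal 0 v) ≤ 2 * Real.exp (-(1 / (2 * v))) := by
  set u : ℝ := 1 / v with hu
  have hu2 : 2 ≤ u := by
    rw [hu, le_div_iff₀ hv0]; linarith
  calc ∫ t, sqTail t ∂(gaussianReal 0 v)
      ≤ ∫ t, (Real.exp (u * t - u) + Real.exp ((-u) * t - u)) ∂(gaussianReal 0 v) := by
        apply integral_mono_of_nonneg (ae_of_all _ sqTail_nonneg)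
        · exact (integrable_exp_mul_sub_gaussianReal v u u).add
            (integrable_exp_mul_sub_gaussianReal v (-u) u)
        · exact ae_of_all _ fun t => sqTail_le_exp u t hu2
    _ = Real.exp (v * u ^ 2 / 2 - u) + Real.exp (v * (-u) ^ 2 / 2 - u) := by
        rw [integral_add (integrable_exp_mul_sub_gaussianReal v u u)
          (integrable_exp_mul_sub_gaussianReal v (-u) u),
          integral_exp_mul_sub_gaussianReal, integral_exp_mul_sub_gaussianReal]
    _ = 2 * Real.exp (-(1 / (2 * v))) := by
        have : (v : ℝ) * u ^ 2 / 2 - u = -(1 / (2 * v)) := by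
          rw [hu]; field_simp; ring
        rw [neg_sq, this]; ring

/-- `max(1, t²) ≤ 1 + t² 1_{1<|t|}`. [folklore] -/
theorem max_one_sq_le (t : ℝ) : max 1 (t ^ 2) ≤ 1 + sqTail t := by
  unfold sqTail
  split_ifs with h
  · have : 0 ≤ t ^ 2 := sq_nonneg t
    exact max_le (by linarith) (by linarith)
  · push Not at h
    have : t ^ 2 ≤ 1 := by
      rw [abs_le] at h
      nlinarith [h.1, h.2]
    simp [max_eq_left this]

/-- `max(1,t²) 1_{1<|t|} = t² 1_{1<|t|}`. [folklore] -/
theorem max_one_sq_mul_indicator (t : ℝ) :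
    max 1 (t ^ 2) * (if 1 < |t| then 1 else 0) = sqTail t := by
  unfold sqTail
  split_ifs with h
  · rw [mul_one, max_eq_right]
    have : 1 < |t| ^ 2 := by nlinarith
    rw [sq_abs] at this
    exact this.le
  · rw [mul_zero]

/-- `t ↦ max(1,t²)` is continuous. [folklore] -/
theorem continuous_max_one_sq : Continuous fun t : ℝ => max 1 (t ^ 2) := by fun_prop

/-- The tail integrand is measurable. [folklore] -/
theorem measurable_sqTail : Measurable sqTail := by
  unfold sqTail
  refine Measurable.ite ?_ (by fun_prop) (by fun_prop)
  exact measurableSet_lt measurable_const (by fun_prop)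

/-- `max(1, t²)` is `𝒩(0,v)`-integrable. [folklore] -/
theorem integrable_max_one_sq (v : ℝ≥0) :
    Integrable (fun t : ℝ => max 1 (t ^ 2)) (gaussianReal 0 v) := by
  have h2 : Integrable (fun t : ℝ => t ^ 2) (gaussianReal 0 v) := by
    have := (memLp_id_gaussianReal (μ := 0) (v := v) 2).integrable_norm_pow (by norm_num)
    simpa using this
  have h12 : Integrable (fun t : ℝ => 1 + t ^ 2) (gaussianReal 0 v) := (integrable_const 1).add h2
  refine Integrable.mono' h12 continuous_max_one_sq.aestronglyMeasurable
    (ae_of_all _ fun t => ?_)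
  rw [Real.norm_eq_abs, abs_of_nonneg (by positivity)]
  exact max_le (by nlinarith) (by nlinarith)

/-- The tail integrand is `𝒩(0,v)`-integrable. [folklore] -/
theorem integrable_sqTail (v : ℝ≥0) : Integrable sqTail (gaussianReal 0 v) := by
  refine (integrable_max_one_sq v).mono' measurable_sqTail.aestronglyMeasurable
    (ae_of_all _ fun t => ?_)
  rw [Real.norm_eq_abs, abs_of_nonneg (sqTail_nonneg t)]
  unfold sqTail
  split_ifs
  · exact le_max_right _ _
  · positivity

/-- `∫ max(1,t²) d𝒩(0,v) ≤ 1 + 2e^{-1/(2v)}` for `0 < v ≤ 1/2`. [folklore] -/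
theorem integral_max_one_sq_le (v : ℝ≥0) (hv0 : 0 < (v : ℝ)) (hv : (v : ℝ) ≤ 1 / 2) :
    ∫ t, max 1 (t ^ 2) ∂(gaussianReal 0 v) ≤ 1 + 2 * Real.exp (-(1 / (2 * v))) := by
  calc ∫ t, max 1 (t ^ 2) ∂(gaussianReal 0 v) ≤ ∫ t, (1 + sqTail t) ∂(gaussianReal 0 v) :=
        integral_mono (integrable_max_one_sq v) ((integrable_const 1).add (integrable_sqTail v))
          fun t => max_one_sq_le t
    _ = 1 + ∫ t, sqTail t ∂(gaussianReal 0 v) := by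
        rw [integral_add (integrable_const 1) (integrable_sqTail v)]
        simp
    _ ≤ 1 + 2 * Real.exp (-(1 / (2 * v))) := by
        have := integral_sqTail_gaussianReal_le v hv0 hv
        linarith

/-- `1 ≤ ∫ max(1,t²) d𝒩(0,v)`. [folklore] -/
theorem one_le_integral_max_one_sq (v : ℝ≥0) :
    1 ≤ ∫ t, max 1 (t ^ 2) ∂(gaussianReal 0 v) := by
  calc (1 : ℝ) = ∫ _t, (1 : ℝ) ∂(gaussianReal 0 v) := by simp
    _ ≤ ∫ t, max 1 (t ^ 2) ∂(gaussianReal 0 v) :=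
        integral_mono (integrable_const 1) (integrable_max_one_sq v) fun t => le_max_left _ _

end Tails

/-! ### Claim 5.2: the product `∏ max(1, |zₖ|)` off the cube is negligible -/

section Claim52

/-- `∏ₖ max(1, |zₖ|)`, the bound of Claim 5.1 (Raz–Tal, Claims 5.1–5.2). [cite: RazTalJACM2022, Claim 5.1] -/
noncomputable def maxProd {m : ℕ} (z : Fin m → ℝ) : ℝ := ∏ k, max 1 |z k|

/-- The indicator `1_{1 < |zₖ|}` of coordinate `k` leaving `[-1, 1]`. [cite: RazTalJACM2022, Claim 5.2] -/
noncomputable def coordTailInd {m : ℕ} (k : Fin m) (z : Fin m → ℝ) : ℝ := if 1 < |z k| then 1 else 0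

open Classical in
/-- The indicator `1_{z ≠ trnc(z)}` of leaving the cube `[-1, 1]^m` (Raz–Tal, Claim 5.2; see
`cubeExitInd_eq_ite_trnc`). [cite: RazTalJACM2022, Claim 5.2] -/
noncomputable def cubeExitInd {m : ℕ} (z : Fin m → ℝ) : ℝ := if ∃ k, 1 < |z k| then 1 else 0

/-- `trnc a ≠ a ↔ 1 < |a|`. [cite: RazTalJACM2022, §4.2] -/
theorem trnc_ne_self_iff (a : ℝ) : trnc a ≠ a ↔ 1 < |a| := by
  constructor
  · intro h
    by_contra h'
    exact h (trnc_eq_self (not_lt.1 h'))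
  · intro h h'
    have := abs_trnc_le_one a
    rw [h'] at this
    linarith

open Classical in
/-- `cubeExitInd z = 1_{trnc(z) ≠ z}` (Raz–Tal's indicator `𝟙_{(x,y) ≠ trnc(x,y)}`). [cite: RazTalJACM2022, Claim 5.2] -/
theorem cubeExitInd_eq_ite_trnc {m : ℕ} (z : Fin m → ℝ) :
    cubeExitInd z = if (fun k => trnc (z k)) ≠ z then 1 else 0 := by
  unfold cubeExitInd
  have : (∃ k, 1 < |z k|) ↔ (fun k => trnc (z k)) ≠ z := by
    constructor
    · rintro ⟨k, hk⟩ h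
      exact (trnc_ne_self_iff (z k)).2 hk (congrFun h k)
    · intro h
      by_contra h'
      push Not at h'
      exact h (funext fun k => trnc_eq_self (h' k))
  by_cases h : ∃ k, 1 < |z k|
  · rw [if_pos h, if_pos (this.1 h)]
  · rw [if_neg h, if_neg (fun h' => h (this.2 h'))]

/-- `maxProd z ≥ 1`. [folklore] -/
theorem one_le_maxProd {m : ℕ} (z : Fin m → ℝ) : 1 ≤ maxProd z :=
  Finset.one_le_prod fun _ _ => le_max_left _ _

/-- `maxProd z ≥ 0`. [folklore] -/
theorem maxProd_nonneg {m : ℕ} (z : Fin m → ℝ) : 0 ≤ maxProd z :=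
  zero_le_one.trans (one_le_maxProd z)

/-- `coordTailInd ∈ {0, 1}`: nonnegative. [folklore] -/
theorem coordTailInd_nonneg {m : ℕ} (k : Fin m) (z : Fin m → ℝ) : 0 ≤ coordTailInd k z := by
  unfold coordTailInd; split_ifs <;> norm_num

/-- `coordTailInd ≤ 1`. [folklore] -/
theorem coordTailInd_le_one {m : ℕ} (k : Fin m) (z : Fin m → ℝ) : coordTailInd k z ≤ 1 := by
  unfold coordTailInd; split_ifs <;> norm_num

/-- `coordTailInd² = coordTailInd`. [folklore] -/
theorem coordTailInd_sq {m : ℕ} (k : Fin m) (z : Fin m → ℝ) :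
    coordTailInd k z ^ 2 = coordTailInd k z := by
  unfold coordTailInd; split_ifs <;> norm_num

/-- `cubeExitInd ≥ 0`. [folklore] -/
theorem cubeExitInd_nonneg {m : ℕ} (z : Fin m → ℝ) : 0 ≤ cubeExitInd z := by
  unfold cubeExitInd; split_ifs <;> norm_num

/-- Union bound: `1_{z ∉ [-1,1]^m} ≤ ∑ₖ 1_{1 < |zₖ|}`. [folklore] -/
theorem cubeExitInd_le_sum {m : ℕ} (z : Fin m → ℝ) :
    cubeExitInd z ≤ ∑ k, coordTailInd k z := by
  unfold cubeExitInd
  split_ifs with h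
  · obtain ⟨k, hk⟩ := h
    calc (1 : ℝ) = coordTailInd k z := by unfold coordTailInd; rw [if_pos hk]
      _ ≤ ∑ k, coordTailInd k z :=
        Finset.single_le_sum (fun k _ => coordTailInd_nonneg k z) (Finset.mem_univ k)
  · exact Finset.sum_nonneg fun k _ => coordTailInd_nonneg k z

/-- `(max(1,|t|))² = max(1, t²)`. [folklore] -/
theorem max_one_abs_sq (t : ℝ) : (max 1 |t|) ^ 2 = max 1 (t ^ 2) := by
  rcases le_total 1 |t| with h | h
  · have h2 : 1 ≤ t ^ 2 := by rw [← sq_abs]; nlinarith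
    rw [max_eq_right h, max_eq_right h2, sq_abs]
  · have h2 : t ^ 2 ≤ 1 := by rw [← sq_abs]; nlinarith [abs_nonneg t]
    rw [max_eq_left h, max_eq_left h2, one_pow]

/-- The product over `[2N]` splits into the two halves. [folklore] -/
theorem prod_splitIndex {β : Type*} [CommMonoid β] (n : ℕ) (f : Fin (2 * 2 ^ n) → β) :
    ∏ k, f k = (∏ i, f (xIdx n i)) * ∏ j, f (yIdx n j) := by
  rw [← (splitIndex (2 ^ n)).symm.prod_comp, Fintype.prod_sum_type]
  rfl

variable (n : ℕ)

/-- `∏ᵢ max(1, z_{e i}²)`: the square of the block product `∏ᵢ max(1, |z_{e i}|)` for a half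
`e ∈ {x, y}` (Raz–Tal, proof of Claim 5.2). [cite: RazTalJACM2022, Claim 5.2] -/
noncomputable def blockSq (e : Fin (2 ^ n) → Fin (2 * 2 ^ n)) (z : Fin (2 * 2 ^ n) → ℝ) : ℝ :=
  ∏ i, max 1 (z (e i) ^ 2)

/-- `blockSq ≥ 0`. [folklore] -/
theorem blockSq_nonneg (e : Fin (2 ^ n) → Fin (2 * 2 ^ n)) (z : Fin (2 * 2 ^ n) → ℝ) :
    0 ≤ blockSq n e z :=
  Finset.prod_nonneg fun _ _ => zero_le_one.trans (le_max_left _ _)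

/-- The block product squared is `blockSq`. [folklore] -/
theorem prod_max_abs_sq (e : Fin (2 ^ n) → Fin (2 * 2 ^ n)) (z : Fin (2 * 2 ^ n) → ℝ) :
    (∏ i, max 1 |z (e i)|) ^ 2 = blockSq n e z := by
  rw [blockSq, ← Finset.prod_pow]
  exact Finset.prod_congr rfl fun i _ => max_one_abs_sq _

/-- **AM–GM step of Claim 5.2**: if `∏ₖ max(1,|zₖ|) = A · B` with `A, B` the products over two
halves `e', e`, then for the tail indicator of a coordinate `e i` of the second half and every
`λ > 0`, `2 · ∏ₖ max(1,|zₖ|) · 1_{1<|z_{e i}|} ≤ λ A² + λ⁻¹ B² 1_{1<|z_{e i}|}` (replaces the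
Cauchy–Schwarz step (3) of Raz–Tal's proof). [cite: RazTalJACM2022, Claim 5.2] -/
theorem two_mul_maxProd_ind_le (e e' : Fin (2 ^ n) → Fin (2 * 2 ^ n)) (z : Fin (2 * 2 ^ n) → ℝ)
    (hsplit : maxProd z = (∏ i, max 1 |z (e' i)|) * ∏ i, max 1 |z (e i)|) (i : Fin (2 ^ n))
    {lam : ℝ} (hlam : 0 < lam) :
    2 * (maxProd z * coordTailInd (e i) z) ≤
      lam * blockSq n e' z + lam⁻¹ * (blockSq n e z * coordTailInd (e i) z) := by
  set a : ℝ := ∏ i, max 1 |z (e' i)| with ha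
  set b : ℝ := (∏ i, max 1 |z (e i)|) * coordTailInd (e i) z with hb
  have hab : maxProd z * coordTailInd (e i) z = a * b := by rw [hsplit, hb, mul_assoc]
  have ha2 : blockSq n e' z = a ^ 2 := (prod_max_abs_sq n e' z).symm
  have hb2 : blockSq n e z * coordTailInd (e i) z = b ^ 2 := by
    rw [hb, mul_pow, prod_max_abs_sq, coordTailInd_sq]
  rw [hab, ha2, hb2, show lam⁻¹ * b ^ 2 = b ^ 2 / lam by ring, ← sub_nonneg]
  have : lam * a ^ 2 + b ^ 2 / lam - 2 * (a * b) = (lam * a - b) ^ 2 / lam := by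
    field_simp; ring
  rw [this]; positivity

/-- The Gaussian second moment `m₂ = ∫ max(1,t²) d𝒩(0,ε)`. [cite: RazTalJACM2022, Claim 5.2] -/
noncomputable def gaussMaxSqMoment : ℝ := ∫ t, max 1 (t ^ 2) ∂(gaussianReal 0 (razTalEpsNN n))

/-- The Gaussian tail `η = ∫ t² 1_{1<|t|} d𝒩(0,ε)`. [cite: RazTalJACM2022, Claim 5.2] -/
noncomputable def gaussSqTail : ℝ := ∫ t, sqTail t ∂(gaussianReal 0 (razTalEpsNN n))

/-- `m₂ ≥ 1`. [folklore] -/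
theorem one_le_gaussMaxSqMoment : 1 ≤ gaussMaxSqMoment n := one_le_integral_max_one_sq _

/-- `η ≥ 0`. [folklore] -/
theorem gaussSqTail_nonneg : 0 ≤ gaussSqTail n := integral_nonneg sqTail_nonneg

/-- **`𝔼_{𝒢'} ∏ᵢ max(1, x_i²) = m₂^N`** for a half with law `𝒩(0, ε I_N)` (independence of the
coordinates of a half, Raz–Tal §4.1, proof of Claim 5.2). [cite: RazTalJACM2022, Claim 5.2] -/
theorem integral_blockSq {e : Fin (2 ^ n) → Fin (2 * 2 ^ n)}
    (he : (razTalGaussian n).map (fun z i => z (e i)) = blockGaussian n) :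
    ∫ z, blockSq n e z ∂(razTalGaussian n) = gaussMaxSqMoment n ^ (2 ^ n) := by
  unfold blockSq
  rw [integral_block_razTalGaussian n he (fun x => ∏ i, max 1 (x i ^ 2))
    (Continuous.aestronglyMeasurable (by fun_prop))]
  unfold blockGaussian gaussMaxSqMoment
  rw [integral_fintype_prod_eq_pow (f := fun t : ℝ => max 1 (t ^ 2)), Fintype.card_fin]

/-- `∏ᵢ max(1, x_i²)` is `𝒢'`-integrable. [folklore] -/
theorem integrable_blockSq {e : Fin (2 ^ n) → Fin (2 * 2 ^ n)}
    (he : (razTalGaussian n).map (fun z i => z (e i)) = blockGaussian n) :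
    Integrable (blockSq n e) (razTalGaussian n) := by
  unfold blockSq
  refine integrable_block_razTalGaussian n he (fun x => ∏ i, max 1 (x i ^ 2)) ?_
  unfold blockGaussian
  exact Integrable.fintype_prod (f := fun (_ : Fin (2 ^ n)) (t : ℝ) => max 1 (t ^ 2))
    fun _ => integrable_max_one_sq _

/-- The one-coordinate factorisation used for `𝔼[∏ᵢ max(1,x_i²) 1_{1<|x_{i₀}|}]`. [folklore] -/
theorem prod_max_sq_mul_ind (i₀ : Fin (2 ^ n)) (x : Fin (2 ^ n) → ℝ) :
    (∏ i, max 1 (x i ^ 2)) * (if 1 < |x i₀| then (1 : ℝ) else 0) =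
      ∏ i, (max 1 (x i ^ 2) * if i = i₀ then (if 1 < |x i| then (1 : ℝ) else 0) else 1) := by
  rw [Finset.prod_mul_distrib]
  congr 1
  rw [Finset.prod_ite_eq']
  simp

/-- **`𝔼_{𝒢'} [∏ᵢ max(1, x_i²) · 1_{1<|x_{i₀}|}] = η · m₂^{N-1}`** for a half with law
`𝒩(0, ε I_N)` (Raz–Tal, proof of Claim 5.2: independence within a half and the Gaussian tail). [cite: RazTalJACM2022, Claim 5.2] -/
theorem integral_blockSq_mul_ind {e : Fin (2 ^ n) → Fin (2 * 2 ^ n)}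
    (he : (razTalGaussian n).map (fun z i => z (e i)) = blockGaussian n) (i₀ : Fin (2 ^ n)) :
    ∫ z, blockSq n e z * coordTailInd (e i₀) z ∂(razTalGaussian n) =
      gaussSqTail n * gaussMaxSqMoment n ^ (2 ^ n - 1) := by
  unfold blockSq coordTailInd
  rw [integral_block_razTalGaussian n he
    (fun x => (∏ i, max 1 (x i ^ 2)) * (if 1 < |x i₀| then (1 : ℝ) else 0)) ?_]
  · simp_rw [prod_max_sq_mul_ind n i₀]
    unfold blockGaussian
    rw [integral_fintype_prod_eq_prod
      (f := fun (i : Fin (2 ^ n)) (t : ℝ) =>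
        max 1 (t ^ 2) * if i = i₀ then (if 1 < |t| then (1 : ℝ) else 0) else 1),
      ← Finset.mul_prod_erase _ _ (Finset.mem_univ i₀)]
    simp only [if_true]
    congr 1
    · unfold gaussSqTail
      simp_rw [max_one_sq_mul_indicator]
    · rw [Finset.prod_congr rfl (g := fun _ => gaussMaxSqMoment n), Finset.prod_const,
        Finset.card_erase_of_mem (Finset.mem_univ i₀), Finset.card_univ, Fintype.card_fin]
      intro i hi
      rw [Finset.mem_erase] at hi
      simp [hi.1, gaussMaxSqMoment]
  · refine Measurable.aestronglyMeasurable (Measurable.mul (by fun_prop) ?_)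
    refine Measurable.ite ?_ measurable_const measurable_const
    exact measurableSet_lt measurable_const (by fun_prop)

/-- `∏ᵢ max(1, x_i²) 1_{1<|x_{i₀}|}` is `𝒢'`-integrable. [folklore] -/
theorem integrable_blockSq_mul_ind {e : Fin (2 ^ n) → Fin (2 * 2 ^ n)}
    (he : (razTalGaussian n).map (fun z i => z (e i)) = blockGaussian n) (i₀ : Fin (2 ^ n)) :
    Integrable (fun z => blockSq n e z * coordTailInd (e i₀) z) (razTalGaussian n) := by
  refine (integrable_blockSq n he).mono' ?_ (ae_of_all _ fun z => ?_)
  · refine (integrable_blockSq n he).aestronglyMeasurable.mul (Measurable.aestronglyMeasurable ?_)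
    unfold coordTailInd
    refine Measurable.ite ?_ measurable_const measurable_const
    exact measurableSet_lt measurable_const (by fun_prop)
  · rw [Real.norm_eq_abs, abs_of_nonneg (mul_nonneg (blockSq_nonneg n e z) (coordTailInd_nonneg _ z))]
    exact mul_le_of_le_one_right (blockSq_nonneg n e z) (coordTailInd_le_one _ z)

/-- **Per-coordinate step of Claim 5.2**: for every coordinate `k ∈ [2N]` and `λ > 0`,
`𝔼_{𝒢'}[∏ max(1,|zₖ'|) · 1_{1<|zₖ|}] ≤ (λ m₂^N + λ⁻¹ η m₂^{N-1})/2`. [cite: RazTalJACM2022, Claim 5.2] -/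
theorem integral_maxProd_ind_le (k : Fin (2 * 2 ^ n)) {lam : ℝ} (hlam : 0 < lam) :
    ∫ z, maxProd z * coordTailInd k z ∂(razTalGaussian n) ≤
      (lam * gaussMaxSqMoment n ^ (2 ^ n) +
        lam⁻¹ * (gaussSqTail n * gaussMaxSqMoment n ^ (2 ^ n - 1))) / 2 := by
  -- `k` lies in the half `e`, the other half is `e'`
  obtain ⟨e, e', i, hk, he, he', hsplit⟩ : ∃ (e e' : Fin (2 ^ n) → Fin (2 * 2 ^ n)) (i : Fin (2 ^ n)),
      k = e i ∧ (razTalGaussian n).map (fun z i => z (e i)) = blockGaussian n ∧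
      (razTalGaussian n).map (fun z i => z (e' i)) = blockGaussian n ∧
      ∀ z : Fin (2 * 2 ^ n) → ℝ, maxProd z = (∏ i, max 1 |z (e' i)|) * ∏ i, max 1 |z (e i)| := by
    obtain ⟨a, ha⟩ : ∃ a, (splitIndex (2 ^ n)).symm a = k := ⟨_, Equiv.symm_apply_apply _ k⟩
    rcases a with i | j
    · refine ⟨xIdx n, yIdx n, i, ha.symm, map_xBlock_razTalGaussian n, map_yBlock_razTalGaussian n,
        fun z => ?_⟩
      rw [maxProd, prod_splitIndex, mul_comm]
    · refine ⟨yIdx n, xIdx n, j, ha.symm, map_yBlock_razTalGaussian n, map_xBlock_razTalGaussian n,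
        fun z => ?_⟩
      rw [maxProd, prod_splitIndex]
  subst hk
  have hI := (((integrable_blockSq n he').const_mul lam).add
    ((integrable_blockSq_mul_ind n he i).const_mul lam⁻¹)).div_const 2
  calc ∫ z, maxProd z * coordTailInd (e i) z ∂(razTalGaussian n)
      ≤ ∫ z, (lam * blockSq n e' z + lam⁻¹ * (blockSq n e z * coordTailInd (e i) z)) / 2
          ∂(razTalGaussian n) := by
        refine integral_mono_of_nonneg (ae_of_all _ fun z =>
          mul_nonneg (maxProd_nonneg z) (coordTailInd_nonneg _ z)) hI (ae_of_all _ fun z => ?_)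
        have := two_mul_maxProd_ind_le n e e' z (hsplit z) i hlam
        simp only
        linarith
    _ = (lam * gaussMaxSqMoment n ^ (2 ^ n) +
          lam⁻¹ * (gaussSqTail n * gaussMaxSqMoment n ^ (2 ^ n - 1))) / 2 := by
        rw [integral_div, integral_add ((integrable_blockSq n he').const_mul lam)
          ((integrable_blockSq_mul_ind n he i).const_mul lam⁻¹), integral_const_mul,
          integral_const_mul, integral_blockSq n he', integral_blockSq_mul_ind n he i]

/-- `∏ max(1,|zₖ'|) 1_{1<|zₖ|}` is `𝒢'`-integrable. [folklore] -/
theorem integrable_maxProd_ind (k : Fin (2 * 2 ^ n)) :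
    Integrable (fun z => maxProd z * coordTailInd k z) (razTalGaussian n) := by
  obtain ⟨e, e', i, hk, he, he', hsplit⟩ : ∃ (e e' : Fin (2 ^ n) → Fin (2 * 2 ^ n)) (i : Fin (2 ^ n)),
      k = e i ∧ (razTalGaussian n).map (fun z i => z (e i)) = blockGaussian n ∧
      (razTalGaussian n).map (fun z i => z (e' i)) = blockGaussian n ∧
      ∀ z : Fin (2 * 2 ^ n) → ℝ, maxProd z = (∏ i, max 1 |z (e' i)|) * ∏ i, max 1 |z (e i)| := by
    obtain ⟨a, ha⟩ : ∃ a, (splitIndex (2 ^ n)).symm a = k := ⟨_, Equiv.symm_apply_apply _ k⟩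
    rcases a with i | j
    · refine ⟨xIdx n, yIdx n, i, ha.symm, map_xBlock_razTalGaussian n, map_yBlock_razTalGaussian n,
        fun z => ?_⟩
      rw [maxProd, prod_splitIndex, mul_comm]
    · refine ⟨yIdx n, xIdx n, j, ha.symm, map_yBlock_razTalGaussian n, map_xBlock_razTalGaussian n,
        fun z => ?_⟩
      rw [maxProd, prod_splitIndex]
  subst hk
  have hI : Integrable (fun z => (1 * blockSq n e' z +
      1⁻¹ * (blockSq n e z * coordTailInd (e i) z)) / 2) (razTalGaussian n) :=
    (((integrable_blockSq n he').const_mul 1).add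
      ((integrable_blockSq_mul_ind n he i).const_mul (1 : ℝ)⁻¹)).div_const 2
  refine hI.mono' ?_ (ae_of_all _ fun z => ?_)
  · refine (Continuous.aestronglyMeasurable ?_).mul (Measurable.aestronglyMeasurable ?_)
    · unfold maxProd; fun_prop
    · unfold coordTailInd
      refine Measurable.ite ?_ measurable_const measurable_const
      exact measurableSet_lt measurable_const (by fun_prop)
  · rw [Real.norm_eq_abs, abs_of_nonneg (mul_nonneg (maxProd_nonneg z) (coordTailInd_nonneg _ z))]
    show _ ≤ (1 * blockSq n e' z + 1⁻¹ * (blockSq n e z * coordTailInd (e i) z)) / 2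
    have := two_mul_maxProd_ind_le n e e' z (hsplit z) i one_pos
    linarith

/-- **Claim 5.2, abstract form**: for every `λ > 0`,
`𝔼_{𝒢'}[∏ₖ max(1,|zₖ|) · 1_{z ≠ trnc z}] ≤ 2N · (λ m₂^N + λ⁻¹ η m₂^{N-1})/2` (union bound over
the `2N` coordinates). [cite: RazTalJACM2022, Claim 5.2] -/
theorem integral_maxProd_cubeExitInd_le_of {lam : ℝ} (hlam : 0 < lam) :
    ∫ z, maxProd z * cubeExitInd z ∂(razTalGaussian n) ≤
      (2 * 2 ^ n : ℕ) * ((lam * gaussMaxSqMoment n ^ (2 ^ n) +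
        lam⁻¹ * (gaussSqTail n * gaussMaxSqMoment n ^ (2 ^ n - 1))) / 2) := by
  calc ∫ z, maxProd z * cubeExitInd z ∂(razTalGaussian n)
      ≤ ∫ z, ∑ k, maxProd z * coordTailInd k z ∂(razTalGaussian n) := by
        refine integral_mono_of_nonneg (ae_of_all _ fun z =>
          mul_nonneg (maxProd_nonneg z) (cubeExitInd_nonneg z))
          (integrable_finsetSum _ fun k _ => integrable_maxProd_ind n k) (ae_of_all _ fun z => ?_)
        simp only
        rw [← Finset.mul_sum]
        exact mul_le_mul_of_nonneg_left (cubeExitInd_le_sum z) (maxProd_nonneg z)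
    _ = ∑ k, ∫ z, maxProd z * coordTailInd k z ∂(razTalGaussian n) :=
        integral_finsetSum _ fun k _ => integrable_maxProd_ind n k
    _ ≤ ∑ _k : Fin (2 * 2 ^ n), (lam * gaussMaxSqMoment n ^ (2 ^ n) +
          lam⁻¹ * (gaussSqTail n * gaussMaxSqMoment n ^ (2 ^ n - 1))) / 2 :=
        Finset.sum_le_sum fun k _ => integral_maxProd_ind_le n k hlam
    _ = _ := by
        rw [Finset.sum_const, Finset.card_univ, Fintype.card_fin, nsmul_eq_mul]

/-! #### Numerical values at `ε = 1/(24 ln N)` -/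

/-- `0 < ε` for `n ≥ 1`. [cite: RazTalJACM2022, §4.2] -/
theorem razTalEps_pos {n : ℕ} (hn : 1 ≤ n) : 0 < razTalEps (2 ^ n) := by
  unfold razTalEps
  have := half_lt_log_two_pow hn
  positivity

/-- `ε ≤ 1/2` for `n ≥ 1` (indeed `ε < 1/12`). [cite: RazTalJACM2022, §4.2] -/
theorem razTalEps_le_half {n : ℕ} (hn : 1 ≤ n) : razTalEps (2 ^ n) ≤ 1 / 2 := by
  unfold razTalEps
  have := half_lt_log_two_pow hn
  rw [div_le_div_iff₀ (by positivity) (by norm_num)]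
  linarith

/-- `e^{-1/(2ε)} = N^{-12}` for `ε = 1/(24 ln N)` (Raz–Tal, proof of Claim 5.2 and §7:
`e^{-a/(ε)}`-type quantities are powers of `N`). [cite: RazTalJACM2022, Claim 5.2] -/
theorem exp_neg_inv_two_eps {n : ℕ} (hn : 1 ≤ n) :
    Real.exp (-(1 / (2 * razTalEps (2 ^ n)))) = 1 / ((2 ^ n : ℕ) : ℝ) ^ 12 := by
  have hlog : 0 < Real.log (2 ^ n : ℕ) := by have := half_lt_log_two_pow hn; linarith
  have hN : (0 : ℝ) < (2 ^ n : ℕ) := by positivity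
  have h1 : 1 / (2 * razTalEps (2 ^ n)) = (12 : ℕ) * Real.log (2 ^ n : ℕ) := by
    unfold razTalEps
    field_simp
    norm_num
  rw [h1, Real.exp_neg, Real.exp_nat_mul, Real.exp_log hN, one_div]

/-- `η ≤ 2 N^{-12}`. [cite: RazTalJACM2022, Claim 5.2] -/
theorem gaussSqTail_le {n : ℕ} (hn : 1 ≤ n) : gaussSqTail n ≤ 2 * (1 / ((2 ^ n : ℕ) : ℝ) ^ 12) := by
  rw [← exp_neg_inv_two_eps hn]
  exact integral_sqTail_gaussianReal_le _ (razTalEps_pos hn) (razTalEps_le_half hn)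

/-- `m₂ ≤ 1 + 2 N^{-12}`. [cite: RazTalJACM2022, Claim 5.2] -/
theorem gaussMaxSqMoment_le {n : ℕ} (hn : 1 ≤ n) :
    gaussMaxSqMoment n ≤ 1 + 2 * (1 / ((2 ^ n : ℕ) : ℝ) ^ 12) := by
  rw [← exp_neg_inv_two_eps hn]
  exact integral_max_one_sq_le _ (razTalEps_pos hn) (razTalEps_le_half hn)

/-- `m₂^k ≤ 3` for `k ≤ N` (from `(1 + 2N^{-12})^N ≤ e^{2N^{-11}} ≤ e`). [cite: RazTalJACM2022, Claim 5.2] -/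
theorem gaussMaxSqMoment_pow_le {n : ℕ} (hn : 1 ≤ n) {k : ℕ} (hk : k ≤ 2 ^ n) :
    gaussMaxSqMoment n ^ k ≤ 3 := by
  set N : ℝ := ((2 ^ n : ℕ) : ℝ) with hNdef
  have hN2 : (2 : ℝ) ≤ N := by
    rw [hNdef]; exact_mod_cast Nat.le_self_pow (by omega) 2
  have hm1 := one_le_gaussMaxSqMoment n
  set a : ℝ := 2 * (1 / N ^ 12) with ha
  have ha0 : 0 ≤ a := by positivity
  have hka : (k : ℝ) * a ≤ 1 := by
    have hkN : (k : ℝ) ≤ N := by rw [hNdef]; exact_mod_cast hk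
    rw [ha]
    have hN12 : 2 * N ≤ N ^ 12 := by
      calc 2 * N ≤ N * N := by nlinarith
        _ = N ^ 2 := by ring
        _ ≤ N ^ 12 := pow_le_pow_right₀ (by linarith) (by norm_num)
    have hNpos : 0 < N ^ 12 := by positivity
    calc (k : ℝ) * (2 * (1 / N ^ 12)) = 2 * k / N ^ 12 := by ring
      _ ≤ 2 * N / N ^ 12 := by gcongr
      _ ≤ 1 := by rw [div_le_one hNpos]; exact hN12
  calc gaussMaxSqMoment n ^ k ≤ (1 + a) ^ k := by
        apply pow_le_pow_left₀ (by linarith)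
        rw [ha]; exact gaussMaxSqMoment_le hn
    _ ≤ Real.exp a ^ k := by
        apply pow_le_pow_left₀ (by linarith)
        have := Real.add_one_le_exp a; linarith
    _ = Real.exp (k * a) := by rw [← Real.exp_nat_mul]
    _ ≤ Real.exp 1 := Real.exp_le_exp.2 hka
    _ ≤ 3 := by have := Real.exp_one_lt_d9; linarith

/-- **Raz–Tal, Claim 5.2**:
`𝔼_{(x,y)∼𝒢'}[∏ᵢ max(1,|xᵢ|) · ∏ᵢ max(1,|yᵢ|) · 𝟙_{(x,y) ≠ trnc(x,y)}] ≤ 4 · N^{-2}`, here for all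
`n ≥ 1` (the paper assumes `n` sufficiently large), the two block products being written as one
product over `[2N]` (`maxProd`, cf. `prod_splitIndex`) and the indicator as `cubeExitInd`
(cf. `cubeExitInd_eq_ite_trnc`). The proof replaces the paper's counting of integer boxes by a
union bound over coordinates and AM–GM, with the same Gaussian tail input; it yields `9 N^{-5}`. [cite: RazTalJACM2022, Claim 5.2] -/
theorem razTal_claim52 {n : ℕ} (hn : 1 ≤ n) :
    ∫ z, maxProd z * cubeExitInd z ∂(razTalGaussian n) ≤ 4 / ((2 ^ n : ℕ) : ℝ) ^ 2 := by
  set N : ℝ := ((2 ^ n : ℕ) : ℝ) with hNdef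
  have hN2 : (2 : ℝ) ≤ N := by
    rw [hNdef]; exact_mod_cast Nat.le_self_pow (by omega) 2
  have hNpos : (0 : ℝ) < N := by linarith
  have hlam : (0 : ℝ) < 1 / N ^ 6 := by positivity
  refine (integral_maxProd_cubeExitInd_le_of n hlam).trans ?_
  have hm := gaussMaxSqMoment_pow_le hn (le_refl (2 ^ n))
  have hm' := gaussMaxSqMoment_pow_le hn (Nat.sub_le (2 ^ n) 1)
  have hη := gaussSqTail_le hn
  have hη0 := gaussSqTail_nonneg n
  have hm0 : 0 ≤ gaussMaxSqMoment n ^ (2 ^ n - 1) := pow_nonneg (by linarith [one_le_gaussMaxSqMoment n]) _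
  have hcast : ((2 * 2 ^ n : ℕ) : ℝ) = 2 * N := by rw [hNdef]; push_cast; ring
  rw [hcast]
  -- the bracket is at most `9 / (2 N⁶)`
  have hbr : (1 / N ^ 6 * gaussMaxSqMoment n ^ (2 ^ n) +
      (1 / N ^ 6)⁻¹ * (gaussSqTail n * gaussMaxSqMoment n ^ (2 ^ n - 1))) / 2 ≤ 9 / (2 * N ^ 6) := by
    rw [one_div, inv_inv]
    have h1 : (N ^ 6)⁻¹ * gaussMaxSqMoment n ^ (2 ^ n) ≤ (N ^ 6)⁻¹ * 3 :=
      mul_le_mul_of_nonneg_left hm (by positivity)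
    have h2 : N ^ 6 * (gaussSqTail n * gaussMaxSqMoment n ^ (2 ^ n - 1)) ≤
        N ^ 6 * (2 * (1 / N ^ 12) * 3) := by
      apply mul_le_mul_of_nonneg_left _ (by positivity)
      exact mul_le_mul hη hm' hm0 (by positivity)
    have h3 : N ^ 6 * (2 * (1 / N ^ 12) * 3) = 6 * (N ^ 6)⁻¹ := by
      field_simp; ring
    rw [h3] at h2
    have h4 : (9 : ℝ) / (2 * N ^ 6) = ((N ^ 6)⁻¹ * 3 + 6 * (N ^ 6)⁻¹) / 2 := by
      field_simp; norm_num
    rw [h4]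
    linarith
  calc 2 * N * ((1 / N ^ 6 * gaussMaxSqMoment n ^ (2 ^ n) +
        (1 / N ^ 6)⁻¹ * (gaussSqTail n * gaussMaxSqMoment n ^ (2 ^ n - 1))) / 2)
      ≤ 2 * N * (9 / (2 * N ^ 6)) := mul_le_mul_of_nonneg_left hbr (by positivity)
    _ = 9 / N ^ 5 := by field_simp
    _ ≤ 4 / N ^ 2 := by
        rw [div_le_div_iff₀ (by positivity) (by positivity)]
        have : N ^ 5 = N ^ 2 * N ^ 3 := by ring
        rw [this]
        have hN3 : (8 : ℝ) ≤ N ^ 3 := by nlinarith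
        nlinarith

end Claim52

/-! ### Multilinear functions: Claim 5.1 and Claim 5.3 -/

section Multilinear

/-- A **multilinear function** `F : ℝ^m → ℝ` given by its coefficients,
`F(z) = ∑_{S ⊆ [m]} F̂(S) ∏_{i∈S} zᵢ` (Raz–Tal, §5, first display; §7 Eq. (4)). [cite: RazTalJACM2022, §5] -/
noncomputable def multilinearEval {m : ℕ} (c : Finset (Fin m) → ℝ) (z : Fin m → ℝ) : ℝ :=
  ∑ S, c S * ∏ i ∈ S, z i

/-- The interpolation weights `∏ᵢ (zᵢ wᵢ + 1)/2` of the cube point `w ∈ {±1}^m` at `z ∈ ℝ^m`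
(Raz–Tal, proof of Claim 5.1: `F(x) = ∑_w F(w) ∏ᵢ (xᵢwᵢ+1)/2`). For `z ∈ [-1,1]^m` these are the
rounding probabilities `roundingWeight`. [cite: RazTalJACM2022, Claim 5.1] -/
noncomputable def cubeWeight {m : ℕ} (z : Fin m → ℝ) (w : Fin m → Bool) : ℝ :=
  ∏ i, (1 + sgn (w i) * z i) / 2

/-- The rounding kernel is the interpolation weight of the truncated point. [cite: RazTalJACM2022, §4.2] -/
theorem roundingWeight_eq_cubeWeight {m : ℕ} (z : Fin m → ℝ) (w : Fin m → Bool) :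
    roundingWeight z w = cubeWeight (fun i => trnc (z i)) w := rfl

/-- **Interpolation of monomials**: `∑_w (∏ᵢ (1 + χ(wᵢ) zᵢ)/2) χ_S(w) = ∏_{i∈S} zᵢ`
(Raz–Tal, proof of Claim 5.1 / of Eq. (2)). [cite: RazTalJACM2022, Claim 5.1] -/
theorem sum_cubeWeight_mul_walsh {m : ℕ} (z : Fin m → ℝ) (S : Finset (Fin m)) :
    ∑ w, cubeWeight z w * walsh S w = ∏ i ∈ S, z i := by
  classical
  have key : ∀ w : Fin m → Bool, cubeWeight z w * walsh S w =
      ∏ i, ((1 + sgn (w i) * z i) / 2 * (if i ∈ S then sgn (w i) else 1)) := by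
    intro w
    rw [cubeWeight, walsh, Finset.prod_mul_distrib, ← Finset.prod_filter]
    simp
  simp_rw [key]
  have h := Finset.prod_univ_sum (fun _ : Fin m => (Finset.univ : Finset Bool))
    (fun i b => (1 + sgn b * z i) / 2 * (if i ∈ S then sgn b else 1))
  rw [Fintype.piFinset_univ] at h
  rw [← h]
  simp_rw [sum_bool_roundingFactor_mul]
  rw [← Finset.prod_filter]
  simp

/-- **Multilinear interpolation from the cube** (Raz–Tal, proof of Claim 5.1: "two multilinear
functions that agree on `{±1}^{2N}` must be equal", whence `F(z) = ∑_w F(w) ∏ᵢ (zᵢwᵢ+1)/2`). [cite: RazTalJACM2022, Claim 5.1] -/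
theorem multilinearEval_eq_sum_cube {m : ℕ} (c : Finset (Fin m) → ℝ) (z : Fin m → ℝ) :
    multilinearEval c z = ∑ w, multilinearEval c (fun i => sgn (w i)) * cubeWeight z w := by
  unfold multilinearEval
  simp_rw [Finset.sum_mul]
  rw [Finset.sum_comm]
  refine Finset.sum_congr rfl fun S _ => ?_
  simp_rw [mul_assoc, ← Finset.mul_sum]
  congr 1
  rw [← sum_cubeWeight_mul_walsh z S]
  refine Finset.sum_congr rfl fun w _ => ?_
  rw [walsh, mul_comm]

/-- `(|1 + t| + |1 - t|)/2 = max(1, |t|)`. [folklore] -/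
theorem abs_add_abs_sub_half (t : ℝ) : (|1 + t| + |1 - t|) / 2 = max 1 |t| := by
  rcases le_total 0 (1 + t) with h1 | h1 <;> rcases le_total 0 (1 - t) with h2 | h2
  · rw [abs_of_nonneg h1, abs_of_nonneg h2, max_eq_left (abs_le.2 ⟨by linarith, by linarith⟩)]
    ring
  · rw [abs_of_nonneg h1, abs_of_nonpos h2, abs_of_nonneg (by linarith : (0 : ℝ) ≤ t),
      max_eq_right (by linarith)]
    ring
  · rw [abs_of_nonpos h1, abs_of_nonneg h2, abs_of_nonpos (by linarith : t ≤ 0),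
      max_eq_right (by linarith)]
    ring
  · linarith

/-- **`∑_w |∏ᵢ (zᵢwᵢ+1)/2| = ∏ᵢ max(1, |zᵢ|)`** (Raz–Tal, proof of Claim 5.1, last display). [cite: RazTalJACM2022, Claim 5.1] -/
theorem sum_abs_cubeWeight {m : ℕ} (z : Fin m → ℝ) : ∑ w, |cubeWeight z w| = maxProd z := by
  have key : ∀ w : Fin m → Bool, |cubeWeight z w| = ∏ i, |1 + sgn (w i) * z i| / 2 := by
    intro w
    rw [cubeWeight, Finset.abs_prod]
    refine Finset.prod_congr rfl fun i _ => ?_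
    rw [abs_div, abs_two]
  simp_rw [key]
  have h := Finset.prod_univ_sum (fun _ : Fin m => (Finset.univ : Finset Bool))
    (fun i b => |1 + sgn b * z i| / 2)
  rw [Fintype.piFinset_univ] at h
  rw [← h, maxProd]
  refine Finset.prod_congr rfl fun i _ => ?_
  rw [Fintype.sum_bool, sgn_true, sgn_false, ← abs_add_abs_sub_half]
  ring_nf

/-- **Raz–Tal, Claim 5.1**: a multilinear `F : ℝ^m → ℝ` mapping `{±1}^m` into `[-1, 1]` satisfies
`|F(z)| ≤ ∏ᵢ max(1, |zᵢ|)` for all `z ∈ ℝ^m`. [cite: RazTalJACM2022, Claim 5.1] -/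
theorem razTal_claim51 {m : ℕ} (c : Finset (Fin m) → ℝ)
    (hc : ∀ w : Fin m → Bool, |multilinearEval c (fun i => sgn (w i))| ≤ 1) (z : Fin m → ℝ) :
    |multilinearEval c z| ≤ maxProd z := by
  rw [multilinearEval_eq_sum_cube, ← sum_abs_cubeWeight]
  refine (Finset.abs_sum_le_sum_abs _ _).trans (Finset.sum_le_sum fun w _ => ?_)
  rw [abs_mul]
  exact mul_le_of_le_one_left (abs_nonneg _) (hc w)

/-- On the cube boundary the bound of Claim 5.1 is `1`: `∏ max(1, |trnc wₖ|) = 1`. [folklore] -/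
theorem maxProd_trnc {m : ℕ} (w : Fin m → ℝ) : maxProd (fun k => trnc (w k)) = 1 := by
  unfold maxProd
  exact Finset.prod_eq_one fun k _ => max_eq_left (abs_trnc_le_one _)

/-- Monotonicity of `∏ max(1,|·|)` under coordinatewise domination. [folklore] -/
theorem maxProd_mono {m : ℕ} {w z : Fin m → ℝ} (h : ∀ k, |w k| ≤ max 1 |z k|) :
    maxProd w ≤ maxProd z := by
  unfold maxProd
  refine Finset.prod_le_prod (fun k _ => zero_le_one.trans (le_max_left _ _)) fun k _ => ?_
  exact max_le (le_max_left _ _) (h k)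

/-- **The pointwise estimate behind Claim 5.3**: for `p, p₀ ≥ 0`, `p + p₀ ≤ 1`, `z₀ ∈ [-p₀,p₀]^m`,
`F` multilinear and bounded by `1` on the cube, and `w = z₀ + p z`:
`|F(trnc w) − F(w)| ≤ 2 ∏ₖ max(1,|zₖ|) 𝟙_{z ≠ trnc z}` (Raz–Tal, proof of Claim 5.3). [cite: RazTalJACM2022, Claim 5.3] -/
theorem abs_sub_trnc_le {m : ℕ} (c : Finset (Fin m) → ℝ)
    (hc : ∀ w : Fin m → Bool, |multilinearEval c (fun i => sgn (w i))| ≤ 1)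
    {p p₀ : ℝ} (hp : 0 ≤ p) (hp₀ : 0 ≤ p₀) (hpp : p + p₀ ≤ 1)
    (z₀ : Fin m → ℝ) (hz₀ : ∀ k, |z₀ k| ≤ p₀) (z : Fin m → ℝ) :
    |multilinearEval c (fun k => trnc (z₀ k + p * z k)) -
        multilinearEval c (fun k => z₀ k + p * z k)| ≤ 2 * (maxProd z * cubeExitInd z) := by
  unfold cubeExitInd
  split_ifs with h
  · -- outside the cube: Claim 5.1 twice
    rw [mul_one]
    have h1 := razTal_claim51 c hc (fun k => trnc (z₀ k + p * z k))
    rw [maxProd_trnc] at h1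
    have h2 := razTal_claim51 c hc (fun k => z₀ k + p * z k)
    have h3 : maxProd (fun k => z₀ k + p * z k) ≤ maxProd z := by
      refine maxProd_mono fun k => ?_
      have hzk : |z k| ≤ max 1 |z k| := le_max_right _ _
      have h1k : (1 : ℝ) ≤ max 1 |z k| := le_max_left _ _
      calc |z₀ k + p * z k| ≤ |z₀ k| + |p * z k| := abs_add_le _ _
        _ = |z₀ k| + p * |z k| := by rw [abs_mul, abs_of_nonneg hp]
        _ ≤ p₀ * max 1 |z k| + p * max 1 |z k| := by
            gcongr
            calc |z₀ k| ≤ p₀ := hz₀ k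
              _ = p₀ * 1 := (mul_one _).symm
              _ ≤ p₀ * max 1 |z k| := by gcongr
        _ = (p + p₀) * max 1 |z k| := by ring
        _ ≤ 1 * max 1 |z k| := by gcongr
        _ = max 1 |z k| := one_mul _
    have h4 := one_le_maxProd z
    calc |multilinearEval c (fun k => trnc (z₀ k + p * z k)) -
          multilinearEval c (fun k => z₀ k + p * z k)|
        ≤ |multilinearEval c (fun k => trnc (z₀ k + p * z k))| +
            |multilinearEval c (fun k => z₀ k + p * z k)| := abs_sub _ _
      _ ≤ 1 + maxProd z := by linarith
      _ ≤ 2 * maxProd z := by linarith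
  · -- inside the cube nothing is truncated
    push Not at h
    have : (fun k => trnc (z₀ k + p * z k)) = fun k => z₀ k + p * z k := by
      funext k
      apply trnc_eq_self
      have hzk := h k
      calc |z₀ k + p * z k| ≤ |z₀ k| + |p * z k| := abs_add_le _ _
        _ = |z₀ k| + p * |z k| := by rw [abs_mul, abs_of_nonneg hp]
        _ ≤ p₀ + p * 1 := by gcongr; exact hz₀ k
        _ ≤ 1 := by linarith
    rw [this, sub_self, abs_zero, mul_zero, mul_zero]

/-- The exit indicator is measurable. [folklore] -/
theorem measurable_cubeExitInd {m : ℕ} : Measurable (cubeExitInd : (Fin m → ℝ) → ℝ) := by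
  classical
  unfold cubeExitInd
  refine Measurable.ite ?_ measurable_const measurable_const
  rw [Set.setOf_exists]
  exact MeasurableSet.iUnion fun k => measurableSet_lt measurable_const (by fun_prop)

/-- `∏ max(1,|zₖ|) 𝟙_{z ≠ trnc z}` is `𝒢'`-integrable. [folklore] -/
theorem integrable_maxProd_cubeExitInd (n : ℕ) :
    Integrable (fun z => maxProd z * cubeExitInd z) (razTalGaussian n) := by
  refine (integrable_finsetSum Finset.univ fun k _ => integrable_maxProd_ind n k).mono' ?_
    (ae_of_all _ fun z => ?_)
  · refine (Continuous.aestronglyMeasurable ?_).mul measurable_cubeExitInd.aestronglyMeasurable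
    unfold maxProd; fun_prop
  · rw [Real.norm_eq_abs, abs_of_nonneg (mul_nonneg (maxProd_nonneg z) (cubeExitInd_nonneg z))]
    show _ ≤ ∑ k ∈ Finset.univ, maxProd z * coordTailInd k z
    rw [← Finset.mul_sum]
    exact mul_le_mul_of_nonneg_left (cubeExitInd_le_sum z) (maxProd_nonneg z)

/-- Multilinear functions are continuous. [folklore] -/
theorem continuous_multilinearEval {m : ℕ} (c : Finset (Fin m) → ℝ) :
    Continuous (multilinearEval c) := by
  unfold multilinearEval; fun_prop

/-- **Raz–Tal, Claim 5.3**: let `0 ≤ p, p₀` with `p + p₀ ≤ 1`, `F : ℝ^{2N} → ℝ` multilinear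
mapping `{±1}^{2N}` into `[-1,1]`, and `z₀ ∈ [-p₀, p₀]^{2N}`; then
`𝔼_{z∼𝒢'}|F(trnc(z₀ + p z)) − F(z₀ + p z)| ≤ 8 · N^{-2}` (here for all `n ≥ 1`). [cite: RazTalJACM2022, Claim 5.3] -/
theorem razTal_claim53 {n : ℕ} (hn : 1 ≤ n) (c : Finset (Fin (2 * 2 ^ n)) → ℝ)
    (hc : ∀ w : Fin (2 * 2 ^ n) → Bool, |multilinearEval c (fun i => sgn (w i))| ≤ 1)
    {p p₀ : ℝ} (hp : 0 ≤ p) (hp₀ : 0 ≤ p₀) (hpp : p + p₀ ≤ 1)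
    (z₀ : Fin (2 * 2 ^ n) → ℝ) (hz₀ : ∀ k, |z₀ k| ≤ p₀) :
    ∫ z, |multilinearEval c (fun k => trnc (z₀ k + p * z k)) -
        multilinearEval c (fun k => z₀ k + p * z k)| ∂(razTalGaussian n) ≤
      8 / ((2 ^ n : ℕ) : ℝ) ^ 2 := by
  calc ∫ z, |multilinearEval c (fun k => trnc (z₀ k + p * z k)) -
        multilinearEval c (fun k => z₀ k + p * z k)| ∂(razTalGaussian n)
      ≤ ∫ z, 2 * (maxProd z * cubeExitInd z) ∂(razTalGaussian n) :=
        integral_mono_of_nonneg (ae_of_all _ fun z => abs_nonneg _)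
          ((integrable_maxProd_cubeExitInd n).const_mul 2)
          (ae_of_all _ fun z => abs_sub_trnc_le c hc hp hp₀ hpp z₀ hz₀ z)
    _ = 2 * ∫ z, maxProd z * cubeExitInd z ∂(razTalGaussian n) := integral_const_mul _ _
    _ ≤ 2 * (4 / ((2 ^ n : ℕ) : ℝ) ^ 2) := by
        have := razTal_claim52 hn
        linarith
    _ = 8 / ((2 ^ n : ℕ) : ℝ) ^ 2 := by ring

end Multilinear

/-! ### Claim 6.3: the truncation estimate for `φ`, and Corollary 6.4 -/

section Claim63

/-- The coefficients of `φ` as a multilinear function: `φ̂({xᵢ, yⱼ}) = (H_N)_{ij}/N`, all other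
coefficients `0` (Raz–Tal, §6: "`φ` is a homogeneous polynomial of degree `2`"). [cite: RazTalJACM2022, §6] -/
noncomputable def phiCoeff (n : ℕ) (S : Finset (Fin (2 * 2 ^ n))) : ℝ :=
  ∑ i, ∑ j, if S = {xIdx n i, yIdx n j} then hadamardMatrix n i j / 2 ^ n else 0

/-- `φ` is the multilinear function with coefficients `phiCoeff`. [cite: RazTalJACM2022, §6] -/
theorem multilinearEval_phiCoeff (n : ℕ) (z : Fin (2 * 2 ^ n) → ℝ) :
    multilinearEval (phiCoeff n) z = forrelationPhi n z := by
  unfold multilinearEval phiCoeff forrelationPhi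
  simp_rw [Finset.sum_mul]
  rw [Finset.sum_comm]
  rw [Finset.sum_div]
  refine Finset.sum_congr rfl fun i _ => ?_
  rw [Finset.sum_comm, Finset.sum_div]
  refine Finset.sum_congr rfl fun j _ => ?_
  simp_rw [ite_mul, zero_mul]
  rw [Finset.sum_ite_eq']
  simp only [Finset.mem_univ, if_true]
  rw [Finset.prod_pair (xIdx_ne_yIdx n i j)]
  ring

/-- `|φ| ≤ 1` on `{±1}^{2N}` (Raz–Tal, proof of Claim 6.3: `φ` is the bias of a `{±1}`-valued
algorithm; here by Cauchy–Schwarz and `‖H_N y‖ = ‖y‖`). [cite: RazTalJACM2022, Claim 6.3] -/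
theorem abs_forrelationPhi_sgn_le (n : ℕ) (w : Fin (2 * 2 ^ n) → Bool) :
    |forrelationPhi n (fun k => sgn (w k))| ≤ 1 := by
  set x : Fin (2 ^ n) → ℝ := fun i => sgn (w (xIdx n i)) with hx
  set y : Fin (2 ^ n) → ℝ := fun j => sgn (w (yIdx n j)) with hy
  have hsq : ∀ b : Bool, sgn b ^ 2 = 1 := fun b => by cases b <;> simp
  have hphi : forrelationPhi n (fun k => sgn (w k)) =
      (∑ i, x i * (hadamardMatrix n).mulVec y i) / 2 ^ n := by
    unfold forrelationPhi
    congr 1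
    refine Finset.sum_congr rfl fun i _ => ?_
    rw [Matrix.mulVec, dotProduct, Finset.mul_sum]
    refine Finset.sum_congr rfl fun j _ => ?_
    simp only [hx, hy]; ring
  have hCS := sum_mul_sq_le_sq_mul_sq Finset.univ x ((hadamardMatrix n).mulVec y)
  have hxx : ∑ i, x i ^ 2 = 2 ^ n := by
    simp [hx, hsq]
  have hyy : ∑ i, (hadamardMatrix n).mulVec y i ^ 2 = 2 ^ n := by
    have h := dotProduct_hadamard_mulVec n y
    simp only [dotProduct] at h
    simp_rw [sq, h]
    simp [hy, ← sq, hsq]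
  rw [hxx, hyy] at hCS
  rw [hphi, abs_div, abs_of_pos (by positivity : (0 : ℝ) < 2 ^ n), div_le_one (by positivity)]
  refine abs_le_of_sq_le_sq ?_ (by positivity)
  simpa [sq] using hCS

/-- **The truncation estimate for `φ` holds** (Raz–Tal, proof of Claim 6.3: Claim 5.3 with
`p₀ = 0`, `p = 1`, `z₀ = 0`), for all `n ≥ 1`. [cite: RazTalJACM2022, Claim 6.3] -/
theorem razTal2022_truncation_phi_holds : RazTal2022_truncation_phi := by
  refine ⟨1, fun n hn => ?_⟩
  have h := razTal_claim53 hn (phiCoeff n) (fun w => ?_) (p := 1) (p₀ := 0) zero_le_one le_rfl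
    (by norm_num) (fun _ => 0) (fun _ => by simp)
  · simpa only [zero_add, one_mul, multilinearEval_phiCoeff] using h
  · rw [multilinearEval_phiCoeff]
    exact abs_forrelationPhi_sgn_le n w

/-- **Raz–Tal, Corollary 6.4 holds** (the quantum half of `BQP^𝒪 ⊄ PH^𝒪`, in H21's query model). [cite: RazTalJACM2022, Cor. 6.4] -/
theorem razTal2022_cor64_holds : RazTal2022_cor64 :=
  razTal2022_cor64_of_truncation razTal2022_truncation_phi_holds

/-- **quantum-advantage.S15 from Theorem 7.4 alone**: after this file, `raz_tal_forrelation`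
rests only on Raz–Tal's Theorem 7.4 (`𝒟` fools AC⁰; itself resting on Tal's Lemma 7.1). [cite: RazTalJACM2022, §8.1] -/
theorem raz_tal_forrelation_of_thm74 (h74 : RazTal2022_thm74) : raz_tal_forrelation :=
  raz_tal_forrelation_of_thm74_cor64 h74 razTal2022_cor64_holds

end Claim63

end Literature.Computability.QuantumComplexity
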